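import Literature.Computability.AlgebraicComplexity.BD17MainTheoremProofs
import Mathlib.Algebra.Group.ForwardDiff
import Mathlib.LinearAlgebra.Lagrange
import Mathlib.LinearAlgebra.Matrix.Block
import HarnessLib

/-!
# Bihan–Dickenstein 2017, Thm. 5.1 (optimality of the bounds) — PROVED

F. Bihan, A. Dickenstein, *Descartes' rule of signs for polynomial systems supported on circuits*,
Int. Math. Res. Not. IMRN 2017 (22) 6867–6893 = arXiv:1601.05826 [BihanDickenstein2017], §5,
Thm. 5.1 (held text `paper:arxiv-1601.05826`, p0013:L12 "Theorem 22"). THEOREMS (and the explicit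
data of one construction) ONLY — no named facts; sibling of the statement file
`BD17DescartesCircuits.lean` (cell `val-lit`, row X4-BD17), whose named fact `BD2017_thm_5_1` is
DISCHARGED here BY NAME (`BD2017_thm_5_1_holds`), not restated.

## The printed proof and ours (disclosed deviation)

The print (p0013:L25–p0014:L40) exhibits the system (5.1) of Phillipson–Rojas [P-R] and its sign
variants and COUNTS their positive solutions by the generalisation [Stu] of Viro's patchworking
theorem (mixed subdivisions, binomial truncations) — a theory the tree does not have. The typed
statement is existential ("there exist matrices `A, C` … and an ordering … such that
`sgnvar = 1 + r` and `n_A(C) = 1 + r`"), so we prove it with a DIFFERENT, patchworking-free family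
whose count is exact by elementary calculus, using the Gale correspondence of §4.2 already in the
tree (`BD17.numPosSols_eq_rootCountMult_galeFun`: `n_𝒜(C)` = the number of roots of `g − 1` in
`Δ_P` counted with multiplicity, [BS08]). For `0 ≤ r ≤ n` (`BD17.Thm51.*`):

* Gale dual points ON THE SEGMENT `[(1,0), (0,1)]`: `P_0 = (1,0)`, `P_a = (a, 1)/(a+1)` for the
  "nodes" `a = 1, …, r`, and `P_ℓ = (0,1)` for `ℓ = r+1, …, n+1`; so `p_ℓ(y) = 1 + s_ℓ (y − 1)` with
  `s_0 = 0`, `s_a = 1/(a+1)`, `s_ℓ = 1`, every `p_ℓ(1) = 1`, `Δ_P = (0, ∞)` and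
  `det(P_i, P_j) = s_j − s_i` (`BD17.Thm51.galeDet_eq`);
* the circuit `𝒜 = {0, e_1, …, e_n, m}` (`BD17.Thm51.expo`) whose affine relation (computed by the
  kernel of `A`, `BD17.Thm51.affRel_eq`) is `λ_0 = −c`, `λ_a = c_a := (−1)^{n+a}(n−r+1)·C(r,a)·(a+1)^r`
  (`a = 1..r`), `λ_ℓ = (−1)^n` (`ℓ > r`), `c = (−1)^{n+r}(n−r+1)·r!` — the `c_a`, `a = 0..r`, being the
  Lagrange coefficients of `c (y−1)^r` at the nodes `0, −1, …, −r`
  (`BD17.Thm51.lagrange_identity`: `∑_a c_a ∏_{a'≠a} (y + a') = c (y − 1)^r`);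
* hence the logarithmic derivative of `g = ∏ p_ℓ^{λ_ℓ}` is `g'/g = c (y−1)^r / ∏_{a=0}^{r} (y+a)`
  (`BD17.Thm51.hasDerivAt_galeFun_config`), so `g − 1` vanishes on `(0,∞)` only at `y = 1` (Rolle)
  and there to order exactly `r + 1` (Mathlib `analyticOrderAt_deriv_eq_iff`):
  `n_𝒜(C) = r + 1` (`BD17.Thm51.numPosSols_config`) — ONE positive solution `x = (1, …, 1)` of
  multiplicity `r + 1` (the print's systems have `r + 1` simple solutions; the printed statement
  counts with multiplicity, p0003:L1, and is met either way);
* the ordering `α` = reversal of the block `1..r` (the `s_ℓ` increase along `α`), the maximal set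
  `K = {0, …, r+1}`, `s_α = (−c, c_r, …, c_1, c_0)` ALTERNATING, so `sgnvar(s_α) = r + 1`
  (`BD17.Thm51.signVar_sAlpha_config`); the signature is `{⌊r/2⌋ + 1, n + 1 − ⌊r/2⌋}`
  (`BD17.Thm51.signature_config`), which gives item (2) with `n = a₊ + a₋ − 2` and `r = 2σ − 1`
  (`a₊ ≠ a₋`), `r = 2σ − 2` (`a₊ = a₋`) — as in print, "(2) follows easily from (1)" (p0013:L25).

Honest framing: a typed-literature companion (LADDER-VALIANT V1 ideation source, cell `val-lit`);
real fewnomial theory; nothing here bears on VP versus VNP. With this file every named fact of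
`BD17DescartesCircuits.lean` is a theorem of the tree.

## References

* [BihanDickenstein2017] F. Bihan, A. Dickenstein, IMRN 2017 (22) 6867–6893; arXiv:1601.05826, §5
  Thm. 5.1, §4.2.
* [BihanSottile2008] F. Bihan, F. Sottile, *Gale duality for complete intersections*, Ann. Inst.
  Fourier 58 (2008) 877–891, Thm. 2.2 (through `BD17GaleRootCount`).
* [P-R] K. Phillipson, J. M. Rojas, *Fewnomial systems with many roots, and an adelic tau
  conjecture*, Contemp. Math. 605 (2013) 45–71 (the printed construction, not used).
-/

noncomputable section

open Matrix Finset Polynomial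
open Literature.Algebra.Polynomial (signVar)

namespace Literature.Computability.AlgebraicComplexity

namespace BD17

namespace Thm51

/-! ### The numerical data: `c`, the Lagrange coefficients `c_a`, `λ`, `s` -/

/-- `c = (−1)^{n+r} (n − r + 1) · r!`, the constant of the logarithmic derivative
`g'/g = c (y−1)^r / ∏_{a ≤ r} (y + a)` of our construction. [cite: BihanDickenstein2017, Thm. 5.1 (proof, our construction)] -/
def cval (n r : ℕ) : ℤ := (-1) ^ (n + r) * ((n - r + 1 : ℕ) : ℤ) * (r.factorial : ℤ)

/-- `c_a = (−1)^{n+a} (n − r + 1) · C(r,a) · (a+1)^r`, the Lagrange coefficient of `c (y−1)^r` at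
the node `−a` (`a = 0, …, r`). [cite: BihanDickenstein2017, Thm. 5.1 (proof, our construction)] -/
def coef (n r a : ℕ) : ℤ :=
  (-1) ^ (n + a) * ((n - r + 1 : ℕ) : ℤ) * (r.choose a : ℤ) * ((a : ℤ) + 1) ^ r

/-- The affine relation of our circuit, by index value: `λ_0 = −c`, `λ_a = c_a` (`1 ≤ a ≤ r`),
`λ_ℓ = (−1)^n` (`ℓ > r`). [cite: BihanDickenstein2017, Thm. 5.1 (proof, our construction)] -/
def lamv (n r i : ℕ) : ℤ :=
  if i = 0 then -cval n r else if i ≤ r then coef n r i else (-1) ^ n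

/-- The second coordinates `s_ℓ` of our Gale points `P_ℓ = (1 − s_ℓ, s_ℓ)`: `s_0 = 0`,
`s_a = 1/(a+1)` (`1 ≤ a ≤ r`), `s_ℓ = 1` (`ℓ > r`). [cite: BihanDickenstein2017, Thm. 5.1 (proof, our construction)] -/
def sv (r i : ℕ) : ℝ := if i = 0 then 0 else if i ≤ r then 1 / ((i : ℝ) + 1) else 1

/-- `∑_{a=0}^{r} (−1)^a C(r,a) (a+1)^r = (−1)^r r!` (the `r`-th finite difference of `x^r`).
[cite: BihanDickenstein2017, Thm. 5.1 (proof, our construction)] -/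
theorem sum_neg_one_pow_mul_choose_mul_succ_pow (r : ℕ) :
    ∑ a ∈ Finset.range (r + 1), (-1 : ℤ) ^ a * (r.choose a : ℤ) * ((a : ℤ) + 1) ^ r =
      (-1) ^ r * (r.factorial : ℤ) := by
  have h1 := fwdDiff_iter_eq_sum_shift (h := (1 : ℤ)) (fun x : ℤ => x ^ r) r 1
  have h2 : (fwdDiff (1 : ℤ))^[r] (fun x : ℤ => x ^ r) 1 = (r.factorial : ℤ) := by
    rw [fwdDiff_iter_eq_factorial]
    simp
  rw [h2] at h1
  have h3 : ∑ k ∈ Finset.range (r + 1), ((-1 : ℤ) ^ (r - k) * (r.choose k : ℤ)) * (1 + (k : ℤ)) ^ r =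
      (r.factorial : ℤ) := by
    rw [h1]
    refine Finset.sum_congr rfl fun k _ => ?_
    simp
  calc ∑ a ∈ Finset.range (r + 1), (-1 : ℤ) ^ a * (r.choose a : ℤ) * ((a : ℤ) + 1) ^ r
      = (-1) ^ r * ∑ k ∈ Finset.range (r + 1),
          ((-1 : ℤ) ^ (r - k) * (r.choose k : ℤ)) * (1 + (k : ℤ)) ^ r := by
        rw [Finset.mul_sum]
        refine Finset.sum_congr rfl fun k hk => ?_
        have hk' : k ≤ r := Nat.lt_succ_iff.mp (Finset.mem_range.mp hk)
        have hsgn : (-1 : ℤ) ^ r * (-1) ^ (r - k) = (-1) ^ k := by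
          rw [← pow_add, show r + (r - k) = 2 * (r - k) + k by omega, pow_add, pow_mul]
          simp
        rw [add_comm (1 : ℤ) k, ← hsgn]
        ring
    _ = (-1) ^ r * (r.factorial : ℤ) := by rw [h3]

/-- `∑_{a=0}^{r} c_a = c` (the leading coefficient of the interpolated polynomial).
[cite: BihanDickenstein2017, Thm. 5.1 (proof, our construction)] -/
theorem sum_coef (n r : ℕ) : ∑ a ∈ Finset.range (r + 1), coef n r a = cval n r := by
  have h := sum_neg_one_pow_mul_choose_mul_succ_pow r
  unfold coef cval
  calc ∑ a ∈ Finset.range (r + 1),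
        (-1 : ℤ) ^ (n + a) * ((n - r + 1 : ℕ) : ℤ) * (r.choose a : ℤ) * ((a : ℤ) + 1) ^ r
      = (-1) ^ n * ((n - r + 1 : ℕ) : ℤ) *
          ∑ a ∈ Finset.range (r + 1), (-1 : ℤ) ^ a * (r.choose a : ℤ) * ((a : ℤ) + 1) ^ r := by
        rw [Finset.mul_sum]
        refine Finset.sum_congr rfl fun a _ => ?_
        rw [pow_add]
        ring
    _ = (-1) ^ (n + r) * ((n - r + 1 : ℕ) : ℤ) * (r.factorial : ℤ) := by
        rw [h, pow_add]
        ring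

/-- The sign of `c`: `(−1)^{n+r} c > 0`. [cite: BihanDickenstein2017, Thm. 5.1 (proof, our construction)] -/
theorem neg_one_pow_mul_cval_pos (n r : ℕ) : 0 < (-1 : ℤ) ^ (n + r) * cval n r := by
  unfold cval
  have h1 : (-1 : ℤ) ^ (n + r) * ((-1) ^ (n + r) * ((n - r + 1 : ℕ) : ℤ) * (r.factorial : ℤ)) =
      ((n - r + 1 : ℕ) : ℤ) * (r.factorial : ℤ) := by
    rw [← mul_assoc, ← mul_assoc, ← pow_add, ← two_mul, pow_mul]
    simp
  rw [h1]
  exact mul_pos (by exact_mod_cast Nat.succ_pos _) (by exact_mod_cast Nat.factorial_pos r)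

/-- `c ≠ 0`. [cite: BihanDickenstein2017, Thm. 5.1 (proof, our construction)] -/
theorem cval_ne_zero (n r : ℕ) : cval n r ≠ 0 := by
  have := neg_one_pow_mul_cval_pos n r
  intro h
  rw [h, mul_zero] at this
  exact lt_irrefl _ this

/-- The sign of `c_a`: `(−1)^{n+a} c_a > 0` for `a ≤ r`. [cite: BihanDickenstein2017, Thm. 5.1 (proof, our construction)] -/
theorem neg_one_pow_mul_coef_pos (n r a : ℕ) (ha : a ≤ r) : 0 < (-1 : ℤ) ^ (n + a) * coef n r a := by
  unfold coef
  have h1 : (-1 : ℤ) ^ (n + a) *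
      ((-1) ^ (n + a) * ((n - r + 1 : ℕ) : ℤ) * (r.choose a : ℤ) * ((a : ℤ) + 1) ^ r) =
      ((n - r + 1 : ℕ) : ℤ) * (r.choose a : ℤ) * ((a : ℤ) + 1) ^ r := by
    rw [← mul_assoc, ← mul_assoc, ← mul_assoc, ← pow_add, ← two_mul, pow_mul]
    simp
  rw [h1]
  refine mul_pos (mul_pos (by exact_mod_cast Nat.succ_pos _) (by exact_mod_cast Nat.choose_pos ha)) ?_
  exact pow_pos (by positivity) _

/-- `c_0 = (−1)^n (n − r + 1)`. [cite: BihanDickenstein2017, Thm. 5.1 (proof, our construction)] -/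
theorem coef_zero (n r : ℕ) : coef n r 0 = (-1) ^ n * ((n - r + 1 : ℕ) : ℤ) := by
  simp [coef]

/-- The sign pattern of `λ`: with `τ(0) = r + 1`, `τ(a) = a` (`1 ≤ a ≤ r`), `τ(ℓ) = 0` (`ℓ > r`),
`(−1)^{n + τ(i)} λ_i > 0`. [cite: BihanDickenstein2017, Thm. 5.1 (proof, our construction)] -/
def tau (r i : ℕ) : ℕ := if i = 0 then r + 1 else if i ≤ r then i else 0

/-- `(−1)^{n+τ(i)} λ_i > 0`. [cite: BihanDickenstein2017, Thm. 5.1 (proof, our construction)] -/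
theorem neg_one_pow_mul_lamv_pos (n r i : ℕ) : 0 < (-1 : ℤ) ^ (n + tau r i) * lamv n r i := by
  unfold lamv tau
  by_cases h0 : i = 0
  · simp only [h0, if_true]
    have := neg_one_pow_mul_cval_pos n r
    rw [show n + (r + 1) = (n + r) + 1 by ring, pow_succ]
    linarith
  · simp only [h0, if_false]
    by_cases hr : i ≤ r
    · simp only [hr, if_true]
      exact neg_one_pow_mul_coef_pos n r i hr
    · simp only [hr, if_false, add_zero]
      rw [← pow_add, ← two_mul, pow_mul]
      simp

/-- Every `λ_i ≠ 0` (our configuration is a circuit). [cite: BihanDickenstein2017, Thm. 5.1 (proof, our construction)] -/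
theorem lamv_ne_zero (n r i : ℕ) : lamv n r i ≠ 0 := by
  intro h
  have := neg_one_pow_mul_lamv_pos n r i
  rw [h, mul_zero] at this
  exact lt_irrefl _ this

/-- `0 < λ_i ↔ n + τ(i)` even. [cite: BihanDickenstein2017, Thm. 5.1 (proof, our construction)] -/
theorem lamv_pos_iff (n r i : ℕ) : 0 < lamv n r i ↔ Even (n + tau r i) := by
  have h := neg_one_pow_mul_lamv_pos n r i
  rcases Nat.even_or_odd (n + tau r i) with he | ho
  · rw [he.neg_one_pow, one_mul] at h
    exact ⟨fun _ => he, fun _ => h⟩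
  · rw [ho.neg_one_pow, neg_one_mul, neg_pos] at h
    exact ⟨fun h' => absurd h' (not_lt.mpr h.le), fun he => absurd he (Nat.not_even_iff_odd.mpr ho)⟩

/-- `λ_i < 0 ↔ n + τ(i)` odd. [cite: BihanDickenstein2017, Thm. 5.1 (proof, our construction)] -/
theorem lamv_neg_iff (n r i : ℕ) : lamv n r i < 0 ↔ Odd (n + tau r i) := by
  rw [← Nat.not_even_iff_odd, ← lamv_pos_iff]
  have := lamv_ne_zero n r i
  constructor
  · intro h h'
    exact lt_asymm h h'
  · intro h
    rcases lt_trichotomy (lamv n r i) 0 with h1 | h1 | h1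
    · exact h1
    · exact absurd h1 this
    · exact absurd h1 h

/-- `0 ≤ s_i ≤ 1`. [cite: BihanDickenstein2017, Thm. 5.1 (proof, our construction)] -/
theorem sv_nonneg (r i : ℕ) : 0 ≤ sv r i := by
  unfold sv
  split_ifs <;> positivity

/-- `s_i ≤ 1`. [cite: BihanDickenstein2017, Thm. 5.1 (proof, our construction)] -/
theorem sv_le_one (r i : ℕ) : sv r i ≤ 1 := by
  unfold sv
  split_ifs with h0 h1
  · exact zero_le_one
  · rw [div_le_one (by positivity)]
    have : (0 : ℝ) ≤ i := Nat.cast_nonneg i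
    linarith
  · exact le_rfl

/-- `s_i = 1` iff `i > r`. [cite: BihanDickenstein2017, Thm. 5.1 (proof, our construction)] -/
theorem sv_eq_one_iff (r i : ℕ) : sv r i = 1 ↔ r < i := by
  unfold sv
  split_ifs with h0 h1
  · simp only [zero_ne_one, false_iff, not_lt]; omega
  · constructor
    · intro h
      exfalso
      have hi : (1 : ℝ) ≤ i := by exact_mod_cast Nat.one_le_iff_ne_zero.mpr h0
      rw [div_eq_one_iff_eq (by positivity)] at h
      linarith
    · intro h; omega
  · simp only [true_iff]; omega

/-- `s_i = 0` iff `i = 0`. [cite: BihanDickenstein2017, Thm. 5.1 (proof, our construction)] -/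
theorem sv_eq_zero_iff (r i : ℕ) : sv r i = 0 ↔ i = 0 := by
  unfold sv
  split_ifs with h0 h1
  · simp [h0]
  · simp only [one_div, inv_eq_zero, h0, iff_false]
    positivity
  · simp [h0]

/-- `s` is injective on `{0, …, r + 1}`. [cite: BihanDickenstein2017, Thm. 5.1 (proof, our construction)] -/
theorem sv_injOn (r : ℕ) {i j : ℕ} (hi : i ≤ r + 1) (hj : j ≤ r + 1) (h : sv r i = sv r j) : i = j := by
  by_cases hi0 : i = 0
  · have := (sv_eq_zero_iff r j).mp (by rw [← h]; exact (sv_eq_zero_iff r i).mpr hi0)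
    omega
  by_cases hj0 : j = 0
  · have := (sv_eq_zero_iff r i).mp (by rw [h]; exact (sv_eq_zero_iff r j).mpr hj0)
    omega
  by_cases hir : r < i
  · have := (sv_eq_one_iff r j).mp (by rw [← h]; exact (sv_eq_one_iff r i).mpr hir)
    omega
  by_cases hjr : r < j
  · have := (sv_eq_one_iff r i).mp (by rw [h]; exact (sv_eq_one_iff r j).mpr hjr)
    omega
  have hi' : i ≤ r := not_lt.mp hir
  have hj' : j ≤ r := not_lt.mp hjr
  unfold sv at h
  rw [if_neg hi0, if_pos hi', if_neg hj0, if_pos hj'] at h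
  have h1 : ((i : ℝ) + 1) = (j : ℝ) + 1 := by
    have hi1 : ((i : ℝ) + 1) ≠ 0 := by positivity
    have hj1 : ((j : ℝ) + 1) ≠ 0 := by positivity
    field_simp at h
    linarith
  exact_mod_cast (add_right_cancel h1 : (i : ℝ) = j)

/-- `s` is monotone along our ordering: for `1 ≤ i ≤ j ≤ r`, `s_j ≤ s_i`.
[cite: BihanDickenstein2017, Thm. 5.1 (proof, our construction)] -/
theorem sv_anti {r i j : ℕ} (hi : 1 ≤ i) (hij : i ≤ j) (hj : j ≤ r) : sv r j ≤ sv r i := by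
  unfold sv
  rw [if_neg (by omega), if_pos hj, if_neg (by omega), if_pos (by omega)]
  apply div_le_div_of_nonneg_left zero_le_one (by positivity)
  have : (i : ℝ) ≤ j := by exact_mod_cast hij
  linarith

/-! ### The Lagrange interpolation identity -/

/-- `∏_{x < a} (x − a) = (−1)^a a!` over `ℝ`. [cite: BihanDickenstein2017, Thm. 5.1 (proof, our construction)] -/
theorem prod_range_sub_self (a : ℕ) :
    ∏ x ∈ Finset.range a, ((x : ℝ) - a) = (-1) ^ a * (a.factorial : ℝ) := by
  induction a with
  | zero => simp
  | succ a ih =>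
    rw [Finset.prod_range_succ', Nat.factorial_succ, Nat.cast_mul, pow_succ]
    have h : ∏ k ∈ Finset.range a, (((k + 1 : ℕ) : ℝ) - ((a + 1 : ℕ) : ℝ)) =
        ∏ x ∈ Finset.range a, ((x : ℝ) - a) := by
      refine Finset.prod_congr rfl fun k _ => ?_
      push_cast
      ring
    rw [h, ih]
    push_cast
    ring

/-- `∏_{a' ∈ [0, r], a' ≠ a} (a' − a) = (−1)^a · a! · (r − a)!` (`a ≤ r`).
[cite: BihanDickenstein2017, Thm. 5.1 (proof, our construction)] -/
theorem prod_erase_sub (r a : ℕ) (ha : a ≤ r) :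
    ∏ a' ∈ (Finset.range (r + 1)).erase a, ((a' : ℝ) - a) =
      (-1) ^ a * (a.factorial : ℝ) * ((r - a).factorial : ℝ) := by
  have hsplit : (Finset.range (r + 1)).erase a = Finset.range a ∪ Finset.Ico (a + 1) (r + 1) := by
    ext x
    simp only [Finset.mem_erase, Finset.mem_range, Finset.mem_union, Finset.mem_Ico]
    omega
  have hdisj : Disjoint (Finset.range a) (Finset.Ico (a + 1) (r + 1)) := by
    rw [Finset.disjoint_left]
    intro x hx hx'
    simp only [Finset.mem_range] at hx
    simp only [Finset.mem_Ico] at hx'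
    omega
  rw [hsplit, Finset.prod_union hdisj, prod_range_sub_self, Finset.prod_Ico_eq_prod_range]
  have h2 : ∏ k ∈ Finset.range (r + 1 - (a + 1)), (((a + 1 + k : ℕ) : ℝ) - a) =
      ((r - a).factorial : ℝ) := by
    rw [show r + 1 - (a + 1) = r - a by omega, ← Finset.prod_range_add_one_eq_factorial, Nat.cast_prod]
    refine Finset.prod_congr rfl fun k _ => ?_
    push_cast
    ring
  rw [h2]

/-- **The Lagrange interpolation identity** of our construction:
`∑_{a=0}^{r} (−1)^a C(r,a) (a+1)^r ∏_{a'≠a} (X + a') = (−1)^r r! (X − 1)^r` (both sides have degree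
`≤ r` and agree at the `r + 1` nodes `X = −a`). [cite: BihanDickenstein2017, Thm. 5.1 (proof, our construction)] -/
theorem lagrange_identity (r : ℕ) :
    ∑ a ∈ Finset.range (r + 1), Polynomial.C ((-1 : ℝ) ^ a * (r.choose a : ℝ) * ((a : ℝ) + 1) ^ r) *
        ∏ a' ∈ (Finset.range (r + 1)).erase a, (X + Polynomial.C (a' : ℝ)) =
      Polynomial.C ((-1 : ℝ) ^ r * (r.factorial : ℝ)) * (X - Polynomial.C 1) ^ r := by
  set s : Finset ℝ := (Finset.range (r + 1)).image fun a : ℕ => -(a : ℝ) with hs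
  have hcard : s.card = r + 1 := by
    rw [hs, Finset.card_image_of_injective _ fun a b hab => by
      have : (a : ℝ) = b := neg_inj.mp hab
      exact_mod_cast this]
    exact Finset.card_range _
  apply Polynomial.eq_of_degrees_lt_of_eval_finset_eq s
  · -- degree of the left-hand side `≤ r < r + 1`
    rw [hcard]
    refine lt_of_le_of_lt (Polynomial.degree_le_of_natDegree_le (n := r) ?_)
      (WithBot.coe_lt_coe.mpr (Nat.lt_succ_self r))
    refine Polynomial.natDegree_sum_le_of_forall_le _ _ fun a ha => ?_
    refine (Polynomial.natDegree_C_mul_le _ _).trans ?_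
    refine (Polynomial.natDegree_prod_le _ _).trans ?_
    have hc : ((Finset.range (r + 1)).erase a).card = r := by
      rw [Finset.card_erase_of_mem ha, Finset.card_range, Nat.add_sub_cancel]
    calc ∑ i ∈ (Finset.range (r + 1)).erase a, (X + Polynomial.C (i : ℝ)).natDegree
        ≤ ∑ i ∈ (Finset.range (r + 1)).erase a, 1 :=
          Finset.sum_le_sum (f := fun i : ℕ => (X + Polynomial.C (i : ℝ)).natDegree)
            (g := fun _ => 1) fun i _ => (Polynomial.natDegree_X_add_C (i : ℝ)).le
      _ = r := by rw [Finset.sum_const, smul_eq_mul, mul_one, hc]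
  · rw [hcard]
    refine lt_of_le_of_lt (Polynomial.degree_le_of_natDegree_le (n := r) ?_)
      (WithBot.coe_lt_coe.mpr (Nat.lt_succ_self r))
    refine (Polynomial.natDegree_C_mul_le _ _).trans ?_
    refine (Polynomial.natDegree_pow_le).trans ?_
    rw [Polynomial.natDegree_X_sub_C, mul_one]
  · intro x hx
    rw [hs, Finset.mem_image] at hx
    obtain ⟨a₀, ha₀, rfl⟩ := hx
    have ha₀r : a₀ ≤ r := Nat.lt_succ_iff.mp (Finset.mem_range.mp ha₀)
    rw [Polynomial.eval_finsetSum,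
      Finset.sum_eq_single_of_mem a₀ ha₀ (fun a ha hne => by
        rw [Polynomial.eval_mul, Polynomial.eval_prod]
        apply mul_eq_zero_of_right
        apply Finset.prod_eq_zero (i := a₀) (Finset.mem_erase.mpr ⟨hne.symm, ha₀⟩)
        simp)]
    rw [Polynomial.eval_mul, Polynomial.eval_C, Polynomial.eval_prod]
    have hprod : ∏ a' ∈ (Finset.range (r + 1)).erase a₀,
        Polynomial.eval (-(a₀ : ℝ)) (X + Polynomial.C (a' : ℝ)) =
        (-1) ^ a₀ * (a₀.factorial : ℝ) * ((r - a₀).factorial : ℝ) := by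
      rw [← prod_erase_sub r a₀ ha₀r]
      refine Finset.prod_congr rfl fun a' _ => ?_
      simp only [Polynomial.eval_add, Polynomial.eval_X, Polynomial.eval_C]
      ring
    rw [hprod, Polynomial.eval_mul, Polynomial.eval_C, Polynomial.eval_pow, Polynomial.eval_sub,
      Polynomial.eval_X, Polynomial.eval_C]
    have hfact : (r.choose a₀ : ℝ) * (a₀.factorial : ℝ) * ((r - a₀).factorial : ℝ) = r.factorial := by
      exact_mod_cast Nat.choose_mul_factorial_mul_factorial ha₀r
    have hsq : ((-1 : ℝ) ^ a₀) ^ 2 = 1 := by rw [← pow_mul, mul_comm, pow_mul]; simp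
    have hsqr : ((-1 : ℝ) ^ r) ^ 2 = 1 := by rw [← pow_mul, mul_comm, pow_mul]; simp
    have e1 : (-(a₀ : ℝ) - 1) ^ r = (-1) ^ r * ((a₀ : ℝ) + 1) ^ r := by
      rw [← mul_pow]; ring_nf
    rw [e1]
    calc (-1 : ℝ) ^ a₀ * (r.choose a₀ : ℝ) * ((a₀ : ℝ) + 1) ^ r *
          ((-1) ^ a₀ * (a₀.factorial : ℝ) * ((r - a₀).factorial : ℝ))
        = ((-1 : ℝ) ^ a₀) ^ 2 * ((r.choose a₀ : ℝ) * (a₀.factorial : ℝ) * ((r - a₀).factorial : ℝ)) *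
            ((a₀ : ℝ) + 1) ^ r := by ring
      _ = (r.factorial : ℝ) * ((a₀ : ℝ) + 1) ^ r := by rw [hsq, hfact, one_mul]
      _ = ((-1 : ℝ) ^ r) ^ 2 * (r.factorial : ℝ) * ((a₀ : ℝ) + 1) ^ r := by rw [hsqr, one_mul]
      _ = (-1) ^ r * (r.factorial : ℝ) * ((-1) ^ r * ((a₀ : ℝ) + 1) ^ r) := by ring

/-- `P(y) = ∏_{a=0}^{r} (y + a)`. [cite: BihanDickenstein2017, Thm. 5.1 (proof, our construction)] -/
def nodeProd (r : ℕ) (y : ℝ) : ℝ := ∏ a ∈ Finset.range (r + 1), (y + a)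

/-- `P(y) > 0` for `y > 0`. [cite: BihanDickenstein2017, Thm. 5.1 (proof, our construction)] -/
theorem nodeProd_pos (r : ℕ) {y : ℝ} (hy : 0 < y) : 0 < nodeProd r y :=
  Finset.prod_pos fun a _ => by positivity

/-- **The partial-fraction identity** `∑_{a=0}^{r} c_a / (y + a) = c (y − 1)^r / P(y)` (`y > 0`).
[cite: BihanDickenstein2017, Thm. 5.1 (proof, our construction)] -/
theorem sum_coef_div_eq (n r : ℕ) {y : ℝ} (hy : 0 < y) :
    ∑ a ∈ Finset.range (r + 1), (coef n r a : ℝ) / (y + a) =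
      (cval n r : ℝ) * (y - 1) ^ r / nodeProd r y := by
  have hP := (nodeProd_pos r hy).ne'
  rw [eq_div_iff hP, Finset.sum_mul]
  -- `c_a / (y + a) · P(y) = c_a ∏_{a' ≠ a} (y + a')`
  have hterm : ∀ a ∈ Finset.range (r + 1), (coef n r a : ℝ) / (y + a) * nodeProd r y =
      (coef n r a : ℝ) * ∏ a' ∈ (Finset.range (r + 1)).erase a, (y + a') := by
    intro a ha
    have hya : (y + a) ≠ 0 := by positivity
    rw [nodeProd, ← Finset.mul_prod_erase _ _ ha]
    field_simp
  rw [Finset.sum_congr rfl hterm]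
  -- evaluate the Lagrange identity at `y`
  have hL := congrArg (Polynomial.eval y) (lagrange_identity r)
  simp only [Polynomial.eval_finsetSum, Polynomial.eval_mul, Polynomial.eval_C,
    Polynomial.eval_prod, Polynomial.eval_add, Polynomial.eval_X, Polynomial.eval_pow,
    Polynomial.eval_sub] at hL
  have hcoef : ∀ a, (coef n r a : ℝ) =
      (-1) ^ n * ((n - r + 1 : ℕ) : ℝ) * ((-1 : ℝ) ^ a * (r.choose a : ℝ) * ((a : ℝ) + 1) ^ r) := by
    intro a
    simp only [coef, Int.cast_mul, Int.cast_pow, Int.cast_neg, Int.cast_one, Int.cast_natCast,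
      Int.cast_add, pow_add]
    ring
  have hcval : (cval n r : ℝ) = (-1) ^ n * ((n - r + 1 : ℕ) : ℝ) * ((-1 : ℝ) ^ r * (r.factorial : ℝ)) := by
    simp only [cval, Int.cast_mul, Int.cast_pow, Int.cast_neg, Int.cast_one, Int.cast_natCast, pow_add]
    ring
  calc ∑ a ∈ Finset.range (r + 1), (coef n r a : ℝ) * ∏ a' ∈ (Finset.range (r + 1)).erase a, (y + a')
      = (-1) ^ n * ((n - r + 1 : ℕ) : ℝ) * ∑ a ∈ Finset.range (r + 1),
          ((-1 : ℝ) ^ a * (r.choose a : ℝ) * ((a : ℝ) + 1) ^ r) *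
            ∏ a' ∈ (Finset.range (r + 1)).erase a, (y + a') := by
        rw [Finset.mul_sum]
        refine Finset.sum_congr rfl fun a _ => ?_
        rw [hcoef]
        ring
    _ = (-1) ^ n * ((n - r + 1 : ℕ) : ℝ) * (((-1 : ℝ) ^ r * (r.factorial : ℝ)) * (y - 1) ^ r) := by
        rw [hL]
    _ = (cval n r : ℝ) * (y - 1) ^ r := by rw [hcval]; ring

/-! ### Sums over `Fin m` supported at one index -/

/-- `∑_j [j = k] f j = f k`. [cite: BihanDickenstein2017, Thm. 5.1 (proof, our construction)] -/
theorem sum_ite_val_eq {M : Type*} [AddCommMonoid M] {m : ℕ} (k : ℕ) (hk : k < m)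
    (f : Fin m → M) : ∑ j : Fin m, (if j.val = k then f j else 0) = f ⟨k, hk⟩ := by
  rw [Finset.sum_eq_single ⟨k, hk⟩]
  · simp
  · intro j _ hj
    rw [if_neg]
    exact fun h => hj (Fin.ext h)
  · intro h
    exact absurd (Finset.mem_univ _) h

/-! ### The Gale dual basis `B` and the coefficient matrix `C` -/

/-- Our Gale dual matrix `B`: rows `P_ℓ = (1 − s_ℓ, s_ℓ)` on the segment `[(1,0),(0,1)]`.
[cite: BihanDickenstein2017, Thm. 5.1 (proof, our construction)] -/
def galeB (n r : ℕ) : Matrix (Fin (n + 2)) (Fin 2) ℝ :=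
  Matrix.of fun ℓ t => if t = 0 then 1 - sv r ℓ.val else sv r ℓ.val

/-- `B_{ℓ,0} = 1 − s_ℓ`. [cite: BihanDickenstein2017, Thm. 5.1 (proof, our construction)] -/
theorem galeB_fst (n r : ℕ) (ℓ : Fin (n + 2)) : galeB n r ℓ 0 = 1 - sv r ℓ.val := by
  simp [galeB]

/-- `B_{ℓ,1} = s_ℓ`. [cite: BihanDickenstein2017, Thm. 5.1 (proof, our construction)] -/
theorem galeB_snd (n r : ℕ) (ℓ : Fin (n + 2)) : galeB n r ℓ 1 = sv r ℓ.val := by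
  simp [galeB]

/-- `p_ℓ(y) = 1 − s_ℓ + s_ℓ y = 1 + s_ℓ (y − 1)`. [cite: BihanDickenstein2017, Thm. 5.1 (proof, our construction)] -/
theorem galeLin_galeB (n r : ℕ) (ℓ : Fin (n + 2)) (y : ℝ) :
    galeLin (galeB n r) ℓ y = 1 - sv r ℓ.val + sv r ℓ.val * y := by
  rw [galeLin, galeB_fst, galeB_snd]

/-- `p_ℓ(1) = 1`. [cite: BihanDickenstein2017, Thm. 5.1 (proof, our construction)] -/
theorem galeLin_galeB_one (n r : ℕ) (ℓ : Fin (n + 2)) : galeLin (galeB n r) ℓ 1 = 1 := by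
  rw [galeLin_galeB]
  ring

/-- `p_ℓ(y) > 0` for `y > 0`. [cite: BihanDickenstein2017, Thm. 5.1 (proof, our construction)] -/
theorem galeLin_galeB_pos (n r : ℕ) (ℓ : Fin (n + 2)) {y : ℝ} (hy : 0 < y) :
    0 < galeLin (galeB n r) ℓ y := by
  rw [galeLin_galeB]
  have h0 := sv_nonneg r ℓ.val
  have h1 := sv_le_one r ℓ.val
  nlinarith [mul_nonneg h0 hy.le]

/-- `Δ_P = (0, ∞)` for our configuration (`r ≤ n`). [cite: BihanDickenstein2017, Thm. 5.1 (proof, our construction)] -/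
theorem galeInterval_galeB (n r : ℕ) (hr : r ≤ n) : galeInterval (galeB n r) = Set.Ioi 0 := by
  ext y
  constructor
  · intro hy
    have h := hy (Fin.last (n + 1))
    rw [galeLin_galeB] at h
    have hs : sv r (Fin.last (n + 1)).val = 1 := (sv_eq_one_iff r _).mpr (by simp; omega)
    rw [hs] at h
    simpa using h
  · intro hy ℓ
    exact galeLin_galeB_pos n r ℓ hy

/-- **`det(P_i, P_j) = s_j − s_i`**. [cite: BihanDickenstein2017, Thm. 5.1 (proof, our construction)] -/
theorem galeDet_galeB (n r : ℕ) (i j : Fin (n + 2)) :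
    galeDet (galeB n r) i j = sv r j.val - sv r i.val := by
  rw [galeDet, galeB_fst, galeB_snd, galeB_fst, galeB_snd]
  ring

/-- Our coefficient matrix `C` (rows `e_ℓ − (1 − s_ℓ) e_0 − s_ℓ e_{n+1}`, `ℓ = 1..n`): the system is
`x^{w_ℓ} = (1 − s_ℓ) + s_ℓ x^{w_{n+1}}`. [cite: BihanDickenstein2017, Thm. 5.1 (proof, our construction)] -/
def coefC (n r : ℕ) : Matrix (Fin n) (Fin (n + 2)) ℝ :=
  Matrix.of fun i j =>
    (if j.val = i.val + 1 then (1 : ℝ) else 0) -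
      (1 - sv r (i.val + 1)) * (if j.val = 0 then (1 : ℝ) else 0) -
      sv r (i.val + 1) * (if j.val = n + 1 then (1 : ℝ) else 0)

/-- `(C v)_i = v_{i+1} − (1 − s_{i+1}) v_0 − s_{i+1} v_{n+1}`.
[cite: BihanDickenstein2017, Thm. 5.1 (proof, our construction)] -/
theorem coefC_mulVec (n r : ℕ) (v : Fin (n + 2) → ℝ) (i : Fin n) :
    (coefC n r).mulVec v i =
      v ⟨i.val + 1, by omega⟩ - (1 - sv r (i.val + 1)) * v ⟨0, by omega⟩ -
        sv r (i.val + 1) * v ⟨n + 1, by omega⟩ := by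
  have h1 : ∀ j : Fin (n + 2), coefC n r i j * v j =
      (if j.val = i.val + 1 then v j else 0) - (if j.val = 0 then (1 - sv r (i.val + 1)) * v j else 0) -
        (if j.val = n + 1 then sv r (i.val + 1) * v j else 0) := by
    intro j
    simp only [coefC, Matrix.of_apply]
    have := i.isLt
    split_ifs <;> first | (exfalso; omega) | ring
  simp only [Matrix.mulVec, dotProduct]
  rw [Finset.sum_congr rfl fun j _ => h1 j, Finset.sum_sub_distrib, Finset.sum_sub_distrib,
    sum_ite_val_eq (i.val + 1) (by omega) (fun j => v j),
    sum_ite_val_eq 0 (by omega) (fun j => (1 - sv r (i.val + 1)) * v j),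
    sum_ite_val_eq (n + 1) (by omega) (fun j => sv r (i.val + 1) * v j)]

/-- `s_0 = 0`. [cite: BihanDickenstein2017, Thm. 5.1 (proof, our construction)] -/
theorem sv_zero (r : ℕ) : sv r 0 = 0 := by simp [sv]

/-- `s_{n+1} = 1` (`r ≤ n`). [cite: BihanDickenstein2017, Thm. 5.1 (proof, our construction)] -/
theorem sv_last (n r : ℕ) (hr : r ≤ n) : sv r (n + 1) = 1 := (sv_eq_one_iff r _).mpr (by omega)

/-- **`B` is the normalized Gale basis of `C` at `(0, n+1)`.** [cite: BihanDickenstein2017, Thm. 5.1 (proof, our construction)] -/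
theorem isNormalizedGaleBasis_config (n r : ℕ) (hr : r ≤ n) :
    IsNormalizedGaleBasis (coefC n r) 0 (Fin.last (n + 1)) (galeB n r) where
  mulVec_col := by
    refine Fin.forall_fin_two.mpr ⟨?_, ?_⟩
    · funext i
      rw [coefC_mulVec, Pi.zero_apply, galeB_fst, galeB_fst, galeB_fst, Fin.val_mk, Fin.val_mk,
        Fin.val_mk, sv_zero, sv_last n r hr]
      ring
    · funext i
      rw [coefC_mulVec, Pi.zero_apply, galeB_snd, galeB_snd, galeB_snd, Fin.val_mk, Fin.val_mk,
        Fin.val_mk, sv_zero, sv_last n r hr]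
      ring
  left_fst := by rw [galeB_fst, Fin.val_zero, sv_zero, sub_zero]
  left_snd := by rw [galeB_snd, Fin.val_zero, sv_zero]
  right_fst := by rw [galeB_fst, Fin.val_last, sv_last n r hr, sub_self]
  right_snd := by rw [galeB_snd, Fin.val_last, sv_last n r hr]

/-- The column selection `E` with `C E = 1`. [cite: BihanDickenstein2017, Thm. 5.1 (proof, our construction)] -/
def selE (n : ℕ) : Matrix (Fin (n + 2)) (Fin n) ℝ :=
  Matrix.of fun j i => if j.val = i.val + 1 then 1 else 0

/-- `C E = 1`. [cite: BihanDickenstein2017, Thm. 5.1 (proof, our construction)] -/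
theorem coefC_mul_selE (n r : ℕ) : coefC n r * selE n = 1 := by
  ext i i'
  simp only [Matrix.mul_apply, selE, Matrix.of_apply, mul_ite, mul_one, mul_zero]
  rw [sum_ite_val_eq (i'.val + 1) (by omega) (fun j => coefC n r i j)]
  simp only [coefC, Matrix.of_apply, Matrix.one_apply]
  have := i'.isLt
  rw [if_neg (show ¬ (i'.val + 1 = 0) by omega), if_neg (show ¬ (i'.val + 1 = n + 1) by omega)]
  by_cases h : i = i'
  · subst h
    rw [if_pos rfl, if_pos rfl]
    ring
  · rw [if_neg (fun e => h (Fin.ext (by omega))), if_neg h]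
    ring

/-- **`rk C = n`.** [cite: BihanDickenstein2017, Thm. 5.1 (proof, our construction)] -/
theorem rank_coefC (n r : ℕ) : (coefC n r).rank = n := by
  apply le_antisymm (Matrix.rank_le_height _)
  have h := Matrix.rank_mul_le_left (coefC n r) (selE n)
  rw [coefC_mul_selE, Matrix.rank_one, Fintype.card_fin] at h
  exact h

/-- **(1.5) holds: the all-ones vector is a positive kernel vector of `C`** (every `p_ℓ(1) = 1`).
[cite: BihanDickenstein2017, Thm. 5.1 (proof, our construction)] -/
theorem posConeCond_config (n r : ℕ) : PosConeCond (coefC n r) := by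
  refine ⟨fun _ => 1, fun _ => one_pos, ?_⟩
  funext i
  rw [coefC_mulVec, Pi.zero_apply]
  ring

/-! ### The exponents: the circuit `{0, e_1, …, e_n, m}` and its affine relation -/

/-- `m_k = (−1)^{n+1} λ_{k+1}`, the last exponent vector. [cite: BihanDickenstein2017, Thm. 5.1 (proof, our construction)] -/
def mvec (n r : ℕ) (k : Fin n) : ℤ := (-1) ^ (n + 1) * lamv n r (k.val + 1)

/-- The support `𝒜`: `w_0 = 0`, `w_i = e_i` (`i = 1..n`), `w_{n+1} = m`.
[cite: BihanDickenstein2017, Thm. 5.1 (proof, our construction)] -/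
def expo (n r : ℕ) (j : Fin (n + 2)) (k : Fin n) : ℤ :=
  if j.val = k.val + 1 then 1 else if j.val = n + 1 then mvec n r k else 0

/-- The unit upper-triangular matrix `U` (first row of ones, identity below).
[cite: BihanDickenstein2017, Thm. 5.1 (proof, our construction)] -/
def upperU (R : Type*) [CommRing R] (n : ℕ) : Matrix (Fin (n + 1)) (Fin (n + 1)) R :=
  Matrix.of fun i j => if i = 0 then 1 else if j = i then 1 else 0

/-- `det U = 1`. [cite: BihanDickenstein2017, Thm. 5.1 (proof, our construction)] -/
theorem det_upperU (R : Type*) [CommRing R] (n : ℕ) : (upperU R n).det = 1 := by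
  have htri : (upperU R n).BlockTriangular id := by
    intro i j hij
    simp only [id] at hij
    simp only [upperU, Matrix.of_apply]
    rw [if_neg, if_neg]
    · exact hij.ne
    · intro h
      rw [h] at hij
      exact (Fin.not_lt_zero _ hij).elim
  rw [Matrix.det_of_upperTriangular htri]
  refine Finset.prod_eq_one fun i _ => ?_
  simp [upperU]

/-- `A` without its last column is `U`. [cite: BihanDickenstein2017, Thm. 5.1 (proof, our construction)] -/
theorem expMatrix_submatrix_castSucc (n r : ℕ) :
    (expMatrix (expo n r)).submatrix id Fin.castSucc = upperU ℤ n := by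
  ext i j
  simp only [Matrix.submatrix_apply, id, upperU, Matrix.of_apply, expMatrix]
  refine Fin.cases ?_ (fun k => ?_) i
  · simp
  · rw [Fin.cons_succ, if_neg (Fin.succ_ne_zero k)]
    simp only [expo, Fin.val_castSucc, Fin.ext_iff, Fin.val_succ]
    have := j.isLt
    split_ifs <;> omega

/-- `λ_{n+1} = (−1)^n` (the simplex `{0, e_1, …, e_n}` is unimodular).
[cite: BihanDickenstein2017, Thm. 5.1 (proof, our construction)] -/
theorem affRel_expo_last (n r : ℕ) : affRel (expo n r) (Fin.last (n + 1)) = (-1) ^ n := by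
  rw [affRel, Fin.succAbove_last, expMatrix_submatrix_castSucc, det_upperU, mul_one, Fin.val_last]
  ring

/-- The candidate affine relation `μ = (1 − ∑ m_k, m_1, …, m_n, −1)`.
[cite: BihanDickenstein2017, Thm. 5.1 (proof, our construction)] -/
def muv (n r : ℕ) (j : Fin (n + 2)) : ℤ :=
  if h0 : j.val = 0 then 1 - ∑ k : Fin n, mvec n r k
  else if h1 : j.val = n + 1 then -1 else mvec n r ⟨j.val - 1, by omega⟩

/-- `∑_j μ_j = 0`. [cite: BihanDickenstein2017, Thm. 5.1 (proof, our construction)] -/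
theorem sum_muv (n r : ℕ) : ∑ j : Fin (n + 2), muv n r j = 0 := by
  rw [Fin.sum_univ_succ, Fin.sum_univ_castSucc]
  have h0 : muv n r 0 = 1 - ∑ k : Fin n, mvec n r k := by
    unfold muv
    rw [dif_pos (Fin.val_zero _)]
  have hl : muv n r (Fin.last n).succ = -1 := by
    have e : ((Fin.last n).succ : Fin (n + 2)).val = n + 1 := by simp
    unfold muv
    rw [dif_neg (by omega), dif_pos e]
  have hk : ∀ k : Fin n, muv n r (Fin.castSucc k).succ = mvec n r k := by
    intro k
    have e : ((Fin.castSucc k).succ : Fin (n + 2)).val = k.val + 1 := by simp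
    have := k.isLt
    unfold muv
    rw [dif_neg (by omega), dif_neg (by omega)]
    congr 1
  rw [h0, hl, Finset.sum_congr rfl fun k _ => hk k]
  ring

/-- `A μ = 0`. [cite: BihanDickenstein2017, Thm. 5.1 (proof, our construction)] -/
theorem expMatrix_mulVec_muv (n r : ℕ) : (expMatrix (expo n r)).mulVec (muv n r) = 0 := by
  funext i
  rw [Pi.zero_apply]
  simp only [Matrix.mulVec, dotProduct, expMatrix, Matrix.of_apply]
  refine Fin.cases ?_ (fun k => ?_) i
  · simp only [Fin.cons_zero, one_mul]
    exact sum_muv n r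
  · simp only [Fin.cons_succ]
    have hk := k.isLt
    have h1 : ∀ j : Fin (n + 2), expo n r j k * muv n r j =
        (if j.val = k.val + 1 then muv n r j else 0) +
          (if j.val = n + 1 then mvec n r k * muv n r j else 0) := by
      intro j
      simp only [expo]
      split_ifs <;> first | (exfalso; omega) | ring
    rw [Finset.sum_congr rfl fun j _ => h1 j, Finset.sum_add_distrib,
      sum_ite_val_eq (k.val + 1) (by omega) (fun j => muv n r j),
      sum_ite_val_eq (n + 1) (by omega) (fun j => mvec n r k * muv n r j)]
    have e1 : muv n r ⟨k.val + 1, by omega⟩ = mvec n r k := by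
      unfold muv
      rw [dif_neg (show ¬ ((⟨k.val + 1, by omega⟩ : Fin (n + 2)).val = 0) from by simp),
        dif_neg (show ¬ ((⟨k.val + 1, by omega⟩ : Fin (n + 2)).val = n + 1) from by simp; omega)]
      congr 1
    have e2 : muv n r ⟨n + 1, by omega⟩ = -1 := by
      unfold muv
      rw [dif_neg (show ¬ ((⟨n + 1, by omega⟩ : Fin (n + 2)).val = 0) from by simp),
        dif_pos (show ((⟨n + 1, by omega⟩ : Fin (n + 2)).val = n + 1) from rfl)]
    rw [e1, e2]
    ring

/-- `∑_k m_k = (−1)^{n+1} c + 1`. [cite: BihanDickenstein2017, Thm. 5.1 (proof, our construction)] -/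
theorem sum_mvec (n r : ℕ) (hr : r ≤ n) : ∑ k : Fin n, mvec n r k = (-1) ^ (n + 1) * cval n r + 1 := by
  have hl : ∀ k : Fin n, mvec n r k = (-1) ^ (n + 1) * lamv n r (k.val + 1) := fun k => rfl
  simp only [hl, ← Finset.mul_sum]
  rw [Fin.sum_univ_eq_sum_range (fun i => lamv n r (i + 1)) n]
  have hsplit : ∑ i ∈ Finset.range n, lamv n r (i + 1) =
      ∑ i ∈ Finset.range r, coef n r (i + 1) + ∑ i ∈ Finset.Ico r n, ((-1) ^ n : ℤ) := by
    rw [Finset.range_eq_Ico, ← Finset.sum_Ico_consecutive _ (Nat.zero_le r) hr, ← Finset.range_eq_Ico]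
    congr 1
    · refine Finset.sum_congr rfl fun i hi => ?_
      have := Finset.mem_range.mp hi
      simp only [lamv]
      rw [if_neg (by omega), if_pos (by omega)]
    · refine Finset.sum_congr rfl fun i hi => ?_
      have := (Finset.mem_Ico.mp hi).1
      simp only [lamv]
      rw [if_neg (by omega), if_neg (by omega)]
  have hcoef : ∑ i ∈ Finset.range r, coef n r (i + 1) = cval n r - coef n r 0 := by
    have := sum_coef n r
    rw [Finset.sum_range_succ'] at this
    linarith
  rw [hsplit, hcoef, Finset.sum_const, Nat.card_Ico, coef_zero, nsmul_eq_mul, Nat.cast_sub hr,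
    Nat.cast_succ, Nat.cast_sub hr, pow_succ]
  have hε : ((-1 : ℤ) ^ n) ^ 2 = 1 := by rw [← pow_mul, mul_comm, pow_mul]; simp
  linear_combination hε

/-- **The affine relation of our circuit**: `λ_j = lamv j` for every index `j` (`r ≤ n`).
[cite: BihanDickenstein2017, Thm. 5.1 (proof, our construction)] -/
theorem affRel_expo (n r : ℕ) (hr : r ≤ n) (j : Fin (n + 2)) :
    affRel (expo n r) j = lamv n r j.val := by
  set A := expMatrix (expo n r) with hA
  set v : Fin (n + 2) → ℤ := fun j => affRel (expo n r) j - (-1) ^ (n + 1) * muv n r j with hv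
  have hAv : A.mulVec v = 0 := by
    have h1 : v = affRel (expo n r) - ((-1 : ℤ) ^ (n + 1)) • muv n r := by
      funext j
      simp [hv]
    rw [h1, Matrix.mulVec_sub, Matrix.mulVec_smul, hA, BD17.expMatrix_mulVec_affRel,
      expMatrix_mulVec_muv, smul_zero, sub_zero]
  have hvlast : v (Fin.last (n + 1)) = 0 := by
    simp only [hv, affRel_expo_last]
    have : muv n r (Fin.last (n + 1)) = -1 := by
      unfold muv
      rw [dif_neg (show ¬ ((Fin.last (n + 1)).val = 0) from by simp),
        dif_pos (show (Fin.last (n + 1)).val = n + 1 from by simp)]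
    rw [this, pow_succ]
    ring
  have hU : (upperU ℤ n).mulVec (fun j' => v (Fin.castSucc j')) = 0 := by
    funext i
    have h := congr_fun hAv i
    rw [Pi.zero_apply] at h ⊢
    simp only [Matrix.mulVec, dotProduct] at h ⊢
    rw [Fin.sum_univ_castSucc, hvlast, mul_zero, add_zero] at h
    rw [← expMatrix_submatrix_castSucc]
    simpa [Matrix.submatrix_apply] using h
  have hv' := Matrix.eq_zero_of_mulVec_eq_zero (by rw [det_upperU]; exact one_ne_zero) hU
  have hvz : ∀ j, v j = 0 := by
    intro j
    refine Fin.lastCases hvlast (fun j' => ?_) j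
    exact congr_fun hv' j'
  have hj := hvz j
  simp only [hv, sub_eq_zero] at hj
  rw [hj]
  -- identify `(−1)^{n+1} μ_j` with `lamv j`
  unfold muv
  by_cases h0 : j.val = 0
  · rw [dif_pos h0, sum_mvec n r hr, lamv, if_pos h0]
    have : ((-1 : ℤ) ^ (n + 1)) ^ 2 = 1 := by rw [← pow_mul, mul_comm, pow_mul]; simp
    linear_combination (-cval n r) * this
  · rw [dif_neg h0]
    by_cases h1 : j.val = n + 1
    · rw [dif_pos h1, lamv, if_neg h0, if_neg (by omega), pow_succ]
      ring
    · rw [dif_neg h1, mvec, ← mul_assoc, ← pow_add, ← two_mul, pow_mul]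
      simp only [neg_one_sq, one_pow, one_mul]
      congr 1
      have := j.isLt
      omega

/-- Our configuration is a circuit. [cite: BihanDickenstein2017, Thm. 5.1 (proof, our construction)] -/
theorem isCircuit_config (n r : ℕ) (hr : r ≤ n) : IsCircuit (expo n r) := fun ℓ => by
  rw [affRel_expo n r hr]
  exact lamv_ne_zero n r ℓ.val

/-- The column selection `E'` (first `n + 1` columns). [cite: BihanDickenstein2017, Thm. 5.1 (proof, our construction)] -/
def selE' (n : ℕ) : Matrix (Fin (n + 2)) (Fin (n + 1)) ℝ :=
  Matrix.of fun j i => if j.val = i.val then 1 else 0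

/-- `A E' = U` over `ℝ`. [cite: BihanDickenstein2017, Thm. 5.1 (proof, our construction)] -/
theorem expMatrix_real_mul_selE' (n r : ℕ) :
    (expMatrix (expo n r)).map (Int.cast : ℤ → ℝ) * selE' n = upperU ℝ n := by
  ext i i'
  simp only [Matrix.mul_apply, selE', Matrix.of_apply, mul_ite, mul_one, mul_zero, Matrix.map_apply]
  rw [sum_ite_val_eq i'.val (by omega) (fun j => ((expMatrix (expo n r)) i j : ℝ))]
  have h := congr_fun (congr_fun (expMatrix_submatrix_castSucc n r) i) i'
  simp only [Matrix.submatrix_apply, id] at h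
  have e : (⟨i'.val, by omega⟩ : Fin (n + 2)) = Fin.castSucc i' := Fin.ext rfl
  rw [e, h]
  simp only [upperU, Matrix.of_apply]
  split_ifs <;> simp

/-- **`rk A = n + 1`.** [cite: BihanDickenstein2017, Thm. 5.1 (proof, our construction)] -/
theorem rank_expMatrix_config (n r : ℕ) :
    ((expMatrix (expo n r)).map (Int.cast : ℤ → ℝ)).rank = n + 1 := by
  apply le_antisymm (Matrix.rank_le_height _)
  have h := Matrix.rank_mul_le_left ((expMatrix (expo n r)).map (Int.cast : ℤ → ℝ)) (selE' n)
  rw [expMatrix_real_mul_selE'] at h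
  have hU : (upperU ℝ n).rank = n + 1 := by
    rw [Matrix.rank_of_isUnit _ ((Matrix.isUnit_iff_isUnit_det _).mpr (by rw [det_upperU]; exact isUnit_one)),
      Fintype.card_fin]
  rw [hU] at h
  exact h

/-- **(1.3) holds for our configuration.** [cite: BihanDickenstein2017, Thm. 5.1 (proof, our construction)] -/
theorem rankCond_config (n r : ℕ) : RankCond (expo n r) (coefC n r) :=
  ⟨rank_expMatrix_config n r, rank_coefC n r⟩

/-! ### The logarithmic derivative of `g` and the root count on `Δ_P = (0, ∞)` -/

/-- `S(y) = c (y − 1)^r / P(y)`, the logarithmic derivative of `g`. [cite: BihanDickenstein2017, Thm. 5.1 (proof, our construction)] -/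
def logDer (n r : ℕ) (y : ℝ) : ℝ := (cval n r : ℝ) * (y - 1) ^ r / nodeProd r y

/-- **`∑_ℓ λ_ℓ B_{ℓ,1}/p_ℓ(y) = c (y−1)^r / P(y)`** on `(0, ∞)` (regrouping the `n + 2` indices into
the constant class, the `r` nodes and the class of `(0,1)`, then the partial-fraction identity).
[cite: BihanDickenstein2017, Thm. 5.1 (proof, our construction)] -/
theorem sum_lamv_mul_div_eq (n r : ℕ) (hr : r ≤ n) {y : ℝ} (hy : 0 < y) :
    ∑ ℓ : Fin (n + 2), (lamv n r ℓ.val : ℝ) * (galeB n r ℓ 1 / galeLin (galeB n r) ℓ y) =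
      logDer n r y := by
  set φ : ℕ → ℝ := fun i => (lamv n r i : ℝ) * (sv r i / (1 - sv r i + sv r i * y)) with hφ
  have hφℓ : ∀ ℓ : Fin (n + 2),
      (lamv n r ℓ.val : ℝ) * (galeB n r ℓ 1 / galeLin (galeB n r) ℓ y) = φ ℓ.val := by
    intro ℓ
    simp only [hφ, galeB_snd, galeLin_galeB]
  rw [Finset.sum_congr rfl fun ℓ _ => hφℓ ℓ, Fin.sum_univ_eq_sum_range φ (n + 2),
    Finset.range_eq_Ico, ← Finset.sum_Ico_consecutive φ (Nat.zero_le 1) (by omega : 1 ≤ n + 2),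
    ← Finset.sum_Ico_consecutive φ (by omega : 1 ≤ r + 1) (by omega : r + 1 ≤ n + 2)]
  -- the three pieces
  have h0 : ∑ i ∈ Finset.Ico 0 1, φ i = 0 := by
    rw [show Finset.Ico 0 1 = {0} by rfl, Finset.sum_singleton]
    simp [hφ, sv_zero]
  have h1 : ∑ i ∈ Finset.Ico 1 (r + 1), φ i = ∑ i ∈ Finset.Ico 1 (r + 1), (coef n r i : ℝ) / (y + i) := by
    refine Finset.sum_congr rfl fun i hi => ?_
    obtain ⟨hi1, hi2⟩ := Finset.mem_Ico.mp hi
    simp only [hφ, lamv, sv, if_neg (show i ≠ 0 by omega), if_pos (show i ≤ r by omega)]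
    have h1 : (i : ℝ) + 1 ≠ 0 := by positivity
    have hD : (1 : ℝ) - 1 / ((i : ℝ) + 1) + 1 / ((i : ℝ) + 1) * y = (y + i) / ((i : ℝ) + 1) := by
      field_simp
      ring
    rw [hD, div_div_div_cancel_right₀ h1, mul_one_div]
  have h2 : ∑ i ∈ Finset.Ico (r + 1) (n + 2), φ i = ((n - r + 1 : ℕ) : ℝ) * ((-1) ^ n / y) := by
    have hc : ∀ i ∈ Finset.Ico (r + 1) (n + 2), φ i = (-1) ^ n / y := by
      intro i hi
      obtain ⟨hi1, hi2⟩ := Finset.mem_Ico.mp hi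
      simp only [hφ, lamv, sv, if_neg (show i ≠ 0 by omega), if_neg (show ¬ i ≤ r by omega)]
      push_cast
      rw [show (1 : ℝ) - 1 + 1 * y = y by ring, mul_one_div]
    rw [Finset.sum_congr rfl hc, Finset.sum_const, Nat.card_Ico, nsmul_eq_mul]
    congr 2
    omega
  rw [h0, h1, h2, zero_add, logDer, ← sum_coef_div_eq n r hy, Finset.range_eq_Ico,
    Finset.sum_eq_sum_Ico_succ_bot (by omega : 0 < r + 1), coef_zero]
  push_cast
  ring

/-- **`g' = g · c (y−1)^r / P(y)` on `(0, ∞)`** for `g = ∏ p_ℓ^{λ_ℓ}` of our configuration.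
[cite: BihanDickenstein2017, Thm. 5.1 (proof, our construction)] -/
theorem hasDerivAt_galeFun_config (n r : ℕ) (hr : r ≤ n) {y : ℝ} (hy : 0 < y) :
    HasDerivAt (galeFun (galeB n r) (affRel (expo n r)))
      (galeFun (galeB n r) (affRel (expo n r)) y * logDer n r y) y := by
  have hyI : y ∈ galeInterval (galeB n r) := by
    rw [galeInterval_galeB n r hr]
    exact hy
  have h := hasDerivAt_galeFun (galeB n r) (affRel (expo n r)) hyI
  have hs : ∑ ℓ, ((affRel (expo n r) ℓ : ℤ) : ℝ) * (galeB n r ℓ 1 / galeLin (galeB n r) ℓ y) =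
      logDer n r y := by
    simp only [affRel_expo n r hr]
    exact sum_lamv_mul_div_eq n r hr hy
  rw [hs] at h
  exact h

/-- `g(1) = 1` (every `p_ℓ(1) = 1`). [cite: BihanDickenstein2017, Thm. 5.1 (proof, our construction)] -/
theorem galeFun_config_one (n r : ℕ) (μ : Fin (n + 2) → ℤ) : galeFun (galeB n r) μ 1 = 1 :=
  Finset.prod_eq_one fun ℓ _ => by rw [galeLin_galeB_one, _root_.one_zpow]

/-- **Rolle: between two points of `(0, ∞)` where `g = 1` lies the point `1`** (the only zero of
`g'` on `(0, ∞)`). [cite: BihanDickenstein2017, Thm. 5.1 (proof, our construction)] -/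
theorem one_mem_Ioo_of_galeFun_eq (n r : ℕ) (hr : r ≤ n) {a b : ℝ} (ha : 0 < a) (hab : a < b)
    (hga : galeFun (galeB n r) (affRel (expo n r)) a = 1)
    (hgb : galeFun (galeB n r) (affRel (expo n r)) b = 1) : a < 1 ∧ 1 < b := by
  obtain ⟨ξ, hξ, hξ0⟩ := exists_hasDerivAt_eq_zero hab
    (fun t ht => (hasDerivAt_galeFun_config n r hr (ha.trans_le ht.1)).continuousAt.continuousWithinAt)
    (hga.trans hgb.symm)
    (fun t ht => hasDerivAt_galeFun_config n r hr (ha.trans ht.1))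
  have hξpos : 0 < ξ := ha.trans hξ.1
  have hgξ : 0 < galeFun (galeB n r) (affRel (expo n r)) ξ :=
    galeFun_pos _ _ (by rw [galeInterval_galeB n r hr]; exact hξpos)
  have hL : logDer n r ξ = 0 := by
    rcases mul_eq_zero.mp hξ0 with h | h
    · exact absurd h hgξ.ne'
    · exact h
  have hξ1 : ξ = 1 := by
    unfold logDer at hL
    rcases div_eq_zero_iff.mp hL with hL | hL
    · rcases mul_eq_zero.mp hL with h | h
      · exact absurd h (by exact_mod_cast cval_ne_zero n r)
      · exact sub_eq_zero.mp (pow_eq_zero_iff'.mp h).1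
    · exact absurd hL (nodeProd_pos r hξpos).ne'
  rw [hξ1] at hξ
  exact ⟨hξ.1, hξ.2⟩

/-- **The zero set of `g − 1` on `Δ_P` is `{1}`.** [cite: BihanDickenstein2017, Thm. 5.1 (proof, our construction)] -/
theorem zeroSet_config (n r : ℕ) (hr : r ≤ n) :
    {y | y ∈ galeInterval (galeB n r) ∧ galeFun (galeB n r) (affRel (expo n r)) y - 1 = 0} = {1} := by
  ext y
  simp only [Set.mem_setOf_eq, Set.mem_singleton_iff, galeInterval_galeB n r hr, Set.mem_Ioi,
    sub_eq_zero]
  constructor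
  · rintro ⟨hy, h⟩
    by_contra hne
    rcases lt_or_gt_of_ne hne with hlt | hgt
    · exact lt_irrefl (1 : ℝ)
        (one_mem_Ioo_of_galeFun_eq n r hr hy hlt h (galeFun_config_one n r _)).2
    · exact lt_irrefl (1 : ℝ)
        (one_mem_Ioo_of_galeFun_eq n r hr one_pos hgt (galeFun_config_one n r _) h).1
  · rintro rfl
    exact ⟨one_pos, galeFun_config_one n r _⟩

/-- **`g − 1` vanishes at `1` to order exactly `r + 1`** (`ord(g−1) = ord(g') + 1` and
`g' = (y−1)^r · (c g / P)` with `c g(1)/P(1) ≠ 0`). [cite: BihanDickenstein2017, Thm. 5.1 (proof, our construction)] -/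
theorem analyticOrderAt_config (n r : ℕ) (hr : r ≤ n) :
    analyticOrderAt (fun y => galeFun (galeB n r) (affRel (expo n r)) y - 1) 1 = (r + 1 : ℕ) := by
  set g := galeFun (galeB n r) (affRel (expo n r)) with hg
  have h1I : (1 : ℝ) ∈ galeInterval (galeB n r) := by
    rw [galeInterval_galeB n r hr]
    exact Set.mem_Ioi.mpr one_pos
  have hga : AnalyticAt ℝ g 1 := analyticOnNhd_galeFun _ _ 1 h1I
  have hfa : AnalyticAt ℝ (fun y => g y - 1) 1 := hga.sub analyticAt_const
  have hf0 : (fun y => g y - 1) 1 = 0 := by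
    simp only [hg, galeFun_config_one, sub_self]
  rw [Nat.cast_add, Nat.cast_one, analyticOrderAt_deriv_eq_iff hfa hf0]
  have hev : deriv (fun y => g y - 1) =ᶠ[nhds 1]
      fun y => (y - 1) ^ r * ((cval n r : ℝ) * g y / nodeProd r y) := by
    filter_upwards [Ioi_mem_nhds (zero_lt_one : (0 : ℝ) < 1)] with y hy
    have hd : HasDerivAt (fun y => g y - 1) (g y * logDer n r y) y :=
      (hasDerivAt_galeFun_config n r hr hy).sub_const 1
    rw [hd.deriv, logDer]
    ring
  rw [analyticOrderAt_congr hev]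
  have hP : AnalyticAt ℝ (fun y => nodeProd r y) 1 := by
    unfold nodeProd
    exact Finset.analyticAt_fun_prod _ fun a _ => by fun_prop
  have hA1 : AnalyticAt ℝ (fun y : ℝ => (y - 1) ^ r) 1 := by fun_prop
  have hA2 : AnalyticAt ℝ (fun y => (cval n r : ℝ) * g y / nodeProd r y) 1 :=
    (analyticAt_const.mul hga).div hP (nodeProd_pos r one_pos).ne'
  have hmul : (fun y => (y - 1) ^ r * ((cval n r : ℝ) * g y / nodeProd r y)) =
      (fun y : ℝ => (y - 1) ^ r) * fun y => (cval n r : ℝ) * g y / nodeProd r y := rfl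
  rw [hmul, analyticOrderAt_mul hA1 hA2]
  have e1 : analyticOrderAt (fun y : ℝ => (y - 1) ^ r) 1 = r := by
    have := analyticOrderAt_centeredMonomial (𝕜 := ℝ) (z₀ := (1 : ℝ)) (n := r)
    exact this
  have e2 : analyticOrderAt (fun y => (cval n r : ℝ) * g y / nodeProd r y) 1 = 0 := by
    rw [hA2.analyticOrderAt_eq_zero]
    refine div_ne_zero (mul_ne_zero (by exact_mod_cast cval_ne_zero n r) ?_) (nodeProd_pos r one_pos).ne'
    rw [hg, galeFun_config_one]
    exact one_ne_zero
  rw [e1, e2, add_zero]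

/-- **The number of roots of `g − 1` in `Δ_P`, counted with multiplicity, is `r + 1`.**
[cite: BihanDickenstein2017, Thm. 5.1 (proof, our construction)] -/
theorem rootCountMult_config (n r : ℕ) (hr : r ≤ n) :
    rootCountMult (fun y => galeFun (galeB n r) (affRel (expo n r)) y - 1) (galeInterval (galeB n r)) =
      r + 1 := by
  unfold rootCountMult
  rw [zeroSet_config n r hr, finsum_mem_singleton, analyticOrderNatAt, analyticOrderAt_config n r hr,
    ENat.toNat_coe]

/-- The cleared polynomial of our configuration is nonzero (`g(2) ≠ 1`).
[cite: BihanDickenstein2017, Thm. 5.1 (proof, our construction)] -/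
theorem galePoly_config_ne_zero (n r : ℕ) (hr : r ≤ n) :
    galePoly (galeB n r) (affRel (expo n r)) ≠ 0 := by
  intro h0
  have h2I : (2 : ℝ) ∈ galeInterval (galeB n r) := by
    rw [galeInterval_galeB n r hr]
    exact Set.mem_Ioi.mpr two_pos
  have h := eval_galePoly_eq_galeDen_mul (galeB n r) (affRel (expo n r)) h2I
  rw [h0, Polynomial.eval_zero] at h
  have hden := galeDen_pos (galeB n r) (affRel (expo n r)) h2I
  have hg : galeFun (galeB n r) (affRel (expo n r)) 2 - 1 = 0 := by
    rcases mul_eq_zero.mp h.symm with h1 | h1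
    · exact absurd h1 hden.ne'
    · exact h1
  have hmem : (2 : ℝ) ∈ {y | y ∈ galeInterval (galeB n r) ∧
      galeFun (galeB n r) (affRel (expo n r)) y - 1 = 0} := ⟨h2I, hg⟩
  rw [zeroSet_config n r hr, Set.mem_singleton_iff] at hmem
  norm_num at hmem

/-- `det C(0, n+1) ≠ 0` (`det(P_0, P_{n+1}) = 1`). [cite: BihanDickenstein2017, Thm. 5.1 (proof, our construction)] -/
theorem coeffMinor_config_ne_zero (n r : ℕ) (hr : r ≤ n) :
    coeffMinor (coefC n r) 0 (Fin.last (n + 1)) ≠ 0 := by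
  have hB := isNormalizedGaleBasis_config n r hr
  have hne : (0 : Fin (n + 2)) ≠ Fin.last (n + 1) := by
    intro h
    have := congrArg Fin.val h
    simp at this
  rw [Ne, coeffMinor_eq_zero_iff_galeDet_eq_zero (coefC n r) (rank_coefC n r)
    (hB.isGaleDual (rank_coefC n r)) hne, galeDet_galeB, Fin.val_zero, Fin.val_last, sv_zero,
    sv_last n r hr]
  norm_num

/-- **`n_𝒜(C) = r + 1` for our configuration.** [cite: BihanDickenstein2017, Thm. 5.1 (proof, our construction)] -/
theorem numPosSols_config (n r : ℕ) (hr : r ≤ n) : numPosSols (expo n r) (coefC n r) = r + 1 := by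
  have hne : (0 : Fin (n + 2)) ≠ Fin.last (n + 1) := by
    intro h
    have := congrArg Fin.val h
    simp at this
  rw [numPosSols_eq_rootCountMult_galeFun (rankCond_config n r) (isCircuit_config n r hr) hne
    (coeffMinor_config_ne_zero n r hr) (isNormalizedGaleBasis_config n r hr)
    (galePoly_config_ne_zero n r hr), rootCountMult_config n r hr]

/-- `n_𝒜(C)` is finite for our configuration. [cite: BihanDickenstein2017, Thm. 5.1 (proof, our construction)] -/
theorem finite_posSolutions_config (n r : ℕ) (hr : r ≤ n) :
    (posSolutions (expo n r) (coefC n r)).Finite := by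
  have hne : (0 : Fin (n + 2)) ≠ Fin.last (n + 1) := by
    intro h
    have := congrArg Fin.val h
    simp at this
  exact finite_posSolutions_of_galePoly_ne_zero (rankCond_config n r) (isCircuit_config n r hr) hne
    (coeffMinor_config_ne_zero n r hr) (isNormalizedGaleBasis_config n r hr)
    (galePoly_config_ne_zero n r hr)

/-! ### The ordering `α` (reversal of the block `1..r`) and the maximal set `K = {0, …, r+1}` -/

/-- The involution reversing the block `1, …, r` of `[n+2]` (identity elsewhere).
[cite: BihanDickenstein2017, Thm. 5.1 (proof, our construction)] -/
def revBlockFun (n r : ℕ) (j : Fin (n + 2)) : Fin (n + 2) :=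
  if h : 1 ≤ j.val ∧ j.val ≤ r ∧ r < n + 2 then ⟨r + 1 - j.val, by omega⟩ else j

/-- The value of the block reversal. [cite: BihanDickenstein2017, Thm. 5.1 (proof, our construction)] -/
theorem revBlockFun_val (n r : ℕ) (j : Fin (n + 2)) :
    (revBlockFun n r j).val = if 1 ≤ j.val ∧ j.val ≤ r ∧ r < n + 2 then r + 1 - j.val else j.val := by
  unfold revBlockFun
  split_ifs <;> rfl

/-- The block reversal is an involution. [cite: BihanDickenstein2017, Thm. 5.1 (proof, our construction)] -/
theorem revBlockFun_involutive (n r : ℕ) : Function.Involutive (revBlockFun n r) := by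
  intro j
  apply Fin.ext
  rw [revBlockFun_val, revBlockFun_val]
  split_ifs <;> omega

/-- **The ordering `α`** of our `C`: `α_0 = 0`, `α_t = r + 1 − t` (`1 ≤ t ≤ r`), `α_t = t` (`t > r`) — along
`α` the second coordinates `s_{α_t}` increase. [cite: BihanDickenstein2017, Thm. 5.1 (proof, our construction)] -/
def revBlock (n r : ℕ) : Equiv.Perm (Fin (n + 2)) :=
  Function.Involutive.toPerm (revBlockFun n r) (revBlockFun_involutive n r)

/-- The value of `α`. [cite: BihanDickenstein2017, Thm. 5.1 (proof, our construction)] -/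
theorem revBlock_val (n r : ℕ) (j : Fin (n + 2)) :
    (revBlock n r j).val = if 1 ≤ j.val ∧ j.val ≤ r ∧ r < n + 2 then r + 1 - j.val else j.val :=
  revBlockFun_val n r j

/-- `α⁻¹ = α`. [cite: BihanDickenstein2017, Thm. 5.1 (proof, our construction)] -/
theorem revBlock_symm (n r : ℕ) : (revBlock n r).symm = revBlock n r := rfl

/-- `s` is non-decreasing along `α`. [cite: BihanDickenstein2017, Thm. 5.1 (proof, our construction)] -/
theorem sv_revBlock_mono (n r : ℕ) (hr : r ≤ n) {i j : Fin (n + 2)} (hij : i < j) :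
    sv r (revBlock n r i).val ≤ sv r (revBlock n r j).val := by
  rw [revBlock_val, revBlock_val]
  have hij' : i.val < j.val := hij
  have hjn := j.isLt
  by_cases hi0 : i.val = 0
  · rw [if_neg (by omega), hi0, sv_zero]
    exact sv_nonneg r _
  by_cases hir : i.val ≤ r
  · rw [if_pos ⟨by omega, hir, by omega⟩]
    by_cases hjr : j.val ≤ r
    · rw [if_pos ⟨by omega, hjr, by omega⟩]
      exact sv_anti (by omega) (by omega) (by omega)
    · rw [if_neg (by omega), (sv_eq_one_iff r j.val).mpr (by omega)]
      exact sv_le_one r _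
  · rw [if_neg (by omega), if_neg (by omega), (sv_eq_one_iff r i.val).mpr (by omega),
      (sv_eq_one_iff r j.val).mpr (by omega)]

/-- **The set `K = {0, 1, …, r + 1}`** (one index per class of proportional Gale points).
[cite: BihanDickenstein2017, Thm. 5.1 (proof, our construction)] -/
def kSet (n r : ℕ) : Finset (Fin (n + 2)) := Finset.univ.filter fun j => j.val < r + 2

/-- `j ∈ K ↔ j < r + 2`. [cite: BihanDickenstein2017, Thm. 5.1 (proof, our construction)] -/
theorem mem_kSet (n r : ℕ) (j : Fin (n + 2)) : j ∈ kSet n r ↔ j.val < r + 2 := by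
  simp [kSet]

/-- `|K| = r + 2`. [cite: BihanDickenstein2017, Thm. 5.1 (proof, our construction)] -/
theorem card_kSet (n r : ℕ) (hr : r ≤ n) : (kSet n r).card = r + 2 := by
  unfold kSet
  rw [Fin.card_filter_val_lt]
  exact min_eq_right (by omega)

/-- `α` preserves `K`. [cite: BihanDickenstein2017, Thm. 5.1 (proof, our construction)] -/
theorem map_kSet (n r : ℕ) : (kSet n r).map (revBlock n r).symm.toEmbedding = kSet n r := by
  ext j
  rw [Finset.mem_map_equiv, Equiv.symm_symm, mem_kSet, mem_kSet, revBlock_val]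
  split_ifs <;> omega

/-- **`ᾱ_t = α_t`** for `t < r + 2` (the positions of `K` under `α` are `0, …, r + 1`).
[cite: BihanDickenstein2017, Thm. 5.1 (proof, our construction)] -/
theorem restrictOrdering_config (n r : ℕ) (hr : r ≤ n) (t : Fin (kSet n r).card) :
    restrictOrdering (revBlock n r) (kSet n r) t =
      revBlock n r (Fin.castLE (by rw [card_kSet n r hr]; omega) t) := by
  have hle : (kSet n r).card ≤ n + 2 := by rw [card_kSet n r hr]; omega
  unfold restrictOrdering
  congr 1
  have hf := Finset.orderEmbOfFin_unique (s := (kSet n r).map (revBlock n r).symm.toEmbedding)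
    (Finset.card_map _) (f := fun t : Fin (kSet n r).card => Fin.castLE hle t)
    (fun t => by
      rw [map_kSet, mem_kSet, Fin.val_castLE]
      have := t.isLt
      have hk := card_kSet n r hr
      omega)
    (fun a b hab => by
      rw [Fin.lt_def, Fin.val_castLE, Fin.val_castLE]
      exact Fin.lt_def.mp hab)
  exact (congr_fun hf t).symm

/-- The value of `ᾱ_t`. [cite: BihanDickenstein2017, Thm. 5.1 (proof, our construction)] -/
theorem restrictOrdering_config_val (n r : ℕ) (hr : r ≤ n) (t : Fin (kSet n r).card) :
    (restrictOrdering (revBlock n r) (kSet n r) t).val =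
      if 1 ≤ t.val ∧ t.val ≤ r then r + 1 - t.val else t.val := by
  rw [restrictOrdering_config n r hr, revBlock_val, Fin.val_castLE]
  by_cases h : 1 ≤ t.val ∧ t.val ≤ r
  · rw [if_pos ⟨h.1, h.2, by omega⟩, if_pos h]
  · rw [if_neg (fun h' => h ⟨h'.1, h'.2.1⟩), if_neg h]

/-- **`α` is an ordering of `C`** (Def. 2.5, via Prop. 2.7 and the minors identity (2.11): the
`det(P_{α_i}, P_{α_j}) = s_{α_j} − s_{α_i} ≥ 0` for `i < j`). [cite: BihanDickenstein2017, Thm. 5.1 (proof, our construction)] -/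
theorem isOrdering_config (n r : ℕ) (hr : r ≤ n) : IsOrdering (coefC n r) (revBlock n r) := by
  have hrk := rank_coefC n r
  have hcone := posConeCond_config n r
  have hBd : IsGaleDual (coefC n r) (galeB n r) :=
    (isNormalizedGaleBasis_config n r hr).isGaleDual hrk
  obtain ⟨δ, hδ, hG⟩ := exists_delta_coeffMinor_eq_galeDet (coefC n r) hrk hBd
  rw [BD2017_prop_2_7_holds n (coefC n r) hrk hcone (revBlock n r)]
  refine ⟨if 0 < δ then 1 else -1, by by_cases h : 0 < δ <;> simp [h], ?_⟩
  rw [minors_sign_iff (coefC n r) (galeB n r) (revBlock n r) hG]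
  intro i j hij
  have hεδ : 0 < (if 0 < δ then (1 : ℝ) else -1) * δ := by
    by_cases h : 0 < δ
    · rw [if_pos h, one_mul]
      exact h
    · rw [if_neg h]
      have : δ < 0 := lt_of_le_of_ne (not_lt.mp h) hδ
      linarith
  rw [galeDet_galeB]
  exact mul_nonneg hεδ.le (sub_nonneg.mpr (sv_revBlock_mono n r hr hij))

/-- `det C(i,j) ≠ 0 ↔ s_i ≠ s_j` (`i ≠ j`). [cite: BihanDickenstein2017, Thm. 5.1 (proof, our construction)] -/
theorem coeffMinor_config_ne_zero_iff (n r : ℕ) (hr : r ≤ n) {i j : Fin (n + 2)} (hij : i ≠ j) :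
    coeffMinor (coefC n r) i j ≠ 0 ↔ sv r i.val ≠ sv r j.val := by
  have hrk := rank_coefC n r
  have hBd : IsGaleDual (coefC n r) (galeB n r) :=
    (isNormalizedGaleBasis_config n r hr).isGaleDual hrk
  rw [Ne, coeffMinor_eq_zero_iff_galeDet_eq_zero (coefC n r) hrk hBd hij, galeDet_galeB, sub_eq_zero,
    eq_comm]

/-- **`K` is a maximal set of indices with pairwise nonzero minors.** [cite: BihanDickenstein2017, Thm. 5.1 (proof, our construction)] -/
theorem isMaxMinorSet_config (n r : ℕ) (hr : r ≤ n) : IsMaxMinorSet (coefC n r) (kSet n r) := by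
  constructor
  · intro i hi j hj hij
    rw [coeffMinor_config_ne_zero_iff n r hr hij]
    rw [mem_kSet] at hi hj
    exact fun h => hij (Fin.ext (sv_injOn r (by omega) (by omega) h))
  · intro K' hK' hM
    obtain ⟨ℓ, hℓK', hℓK⟩ := Finset.exists_of_ssubset hK'
    rw [mem_kSet, not_lt] at hℓK
    have hr1 : (⟨r + 1, by omega⟩ : Fin (n + 2)) ∈ K' :=
      hK'.subset ((mem_kSet n r _).mpr (by simp))
    have hneq : (⟨r + 1, by omega⟩ : Fin (n + 2)) ≠ ℓ := by
      intro h
      have := congrArg Fin.val h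
      simp only at this
      omega
    have h := hM _ hr1 _ hℓK' hneq
    rw [coeffMinor_config_ne_zero_iff n r hr hneq] at h
    apply h
    rw [(sv_eq_one_iff r (r + 1)).mpr (by omega), (sv_eq_one_iff r ℓ.val).mpr (by omega)]

/-! ### The sequence `s_α` and its sign variation -/

/-- The class sums by position: `λ̄_0 = −c`, `λ̄_t = c_{r+1−t}` (`1 ≤ t ≤ r + 1`; `λ̄_{r+1} = c_0`).
[cite: BihanDickenstein2017, Thm. 5.1 (proof, our construction)] -/
def lamBarV (n r t : ℕ) : ℤ := if t = 0 then -cval n r else coef n r (r + 1 - t)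

/-- `(−1)^{n+r+1+t} λ̄_t > 0` (`t ≤ r + 1`): the class sums ALTERNATE in sign.
[cite: BihanDickenstein2017, Thm. 5.1 (proof, our construction)] -/
theorem neg_one_pow_mul_lamBarV_pos (n r t : ℕ) (ht : t ≤ r + 1) :
    0 < (-1 : ℤ) ^ (n + r + 1 + t) * lamBarV n r t := by
  unfold lamBarV
  by_cases h0 : t = 0
  · rw [if_pos h0, h0, add_zero, pow_succ]
    have := neg_one_pow_mul_cval_pos n r
    linarith
  · rw [if_neg h0]
    have h := neg_one_pow_mul_coef_pos n r (r + 1 - t) (by omega)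
    have he : (-1 : ℤ) ^ (n + r + 1 + t) = (-1) ^ (n + (r + 1 - t)) := by
      rw [show n + r + 1 + t = (n + (r + 1 - t)) + 2 * t by omega, pow_add, pow_mul]
      simp
    rw [he]
    exact h

/-- Consecutive class sums have opposite signs. [cite: BihanDickenstein2017, Thm. 5.1 (proof, our construction)] -/
theorem lamBarV_mul_succ_neg (n r t : ℕ) (ht : t + 1 ≤ r + 1) :
    lamBarV n r t * lamBarV n r (t + 1) < 0 := by
  have h1 := neg_one_pow_mul_lamBarV_pos n r t (by omega)
  have h2 := neg_one_pow_mul_lamBarV_pos n r (t + 1) ht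
  rw [show n + r + 1 + (t + 1) = (n + r + 1 + t) + 1 by ring, pow_succ] at h2
  rcases neg_one_pow_eq_or ℤ (n + r + 1 + t) with h | h <;> rw [h] at h1 h2
  · rw [one_mul] at h1
    exact mul_neg_of_pos_of_neg h1 (by linarith)
  · exact mul_neg_of_neg_of_pos (by linarith) (by linarith)

/-- The indices `ℓ > r` (the class of `(0,1)`) number `n − r + 1`.
[cite: BihanDickenstein2017, Thm. 5.1 (proof, our construction)] -/
theorem card_filter_gt (n r : ℕ) (hr : r ≤ n) :
    (Finset.univ.filter fun ℓ : Fin (n + 2) => r < ℓ.val).card = n - r + 1 := by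
  have hc : (Finset.univ.filter fun ℓ : Fin (n + 2) => r < ℓ.val)ᶜ =
      Finset.univ.filter fun ℓ : Fin (n + 2) => ℓ.val < r + 1 := by
    rw [Finset.compl_filter]
    refine Finset.filter_congr fun ℓ _ => ?_
    omega
  have h1 := Finset.card_compl (Finset.univ.filter fun ℓ : Fin (n + 2) => r < ℓ.val)
  rw [hc, Fin.card_filter_val_lt, Fintype.card_fin, min_eq_right (by omega)] at h1
  have h2 := Finset.card_le_univ (Finset.univ.filter fun ℓ : Fin (n + 2) => r < ℓ.val)
  rw [Fintype.card_fin] at h2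
  omega

/-- **The class sums `λ̄_t` of our configuration.** [cite: BihanDickenstein2017, Thm. 5.1 (proof, our construction)] -/
theorem lambdaBar_config (n r : ℕ) (hr : r ≤ n) (t : Fin (kSet n r).card) :
    lambdaBar (expo n r) (coefC n r) (kSet n r) (revBlock n r) t = lamBarV n r t.val := by
  have ht : t.val < r + 2 := by
    have := t.isLt
    have hk := card_kSet n r hr
    omega
  have hrk := rank_coefC n r
  have hBd : IsGaleDual (coefC n r) (galeB n r) :=
    (isNormalizedGaleBasis_config n r hr).isGaleDual hrk
  have hmem : ∀ ℓ, ℓ ∈ minorClass (coefC n r) (kSet n r) (revBlock n r) t ↔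
      sv r ℓ.val = sv r (restrictOrdering (revBlock n r) (kSet n r) t).val := by
    intro ℓ
    rw [mem_minorClass_iff_galeDet_eq_zero (coefC n r) hrk hBd, galeDet_galeB, sub_eq_zero]
  unfold lambdaBar lamBarV
  simp only [affRel_expo n r hr]
  by_cases h0 : t.val = 0
  · -- the class of `(1,0)` is `{0}`
    have hcl : minorClass (coefC n r) (kSet n r) (revBlock n r) t = {0} := by
      ext ℓ
      rw [hmem, restrictOrdering_config_val n r hr, if_neg (by omega), h0, sv_zero, sv_eq_zero_iff,
        Finset.mem_singleton, Fin.ext_iff, Fin.val_zero]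
    rw [hcl, Finset.sum_singleton, if_pos h0, Fin.val_zero, lamv, if_pos rfl]
  · rw [if_neg h0]
    by_cases h1 : t.val ≤ r
    · -- a node class `{r + 1 − t}`
      have hcl : minorClass (coefC n r) (kSet n r) (revBlock n r) t = {⟨r + 1 - t.val, by omega⟩} := by
        ext ℓ
        rw [hmem, restrictOrdering_config_val n r hr, if_pos ⟨by omega, h1⟩, Finset.mem_singleton,
          Fin.ext_iff, Fin.val_mk]
        constructor
        · intro h
          have hℓ : ℓ.val ≤ r + 1 := by
            by_contra hc
            have h1' := (sv_eq_one_iff r ℓ.val).mpr (by omega)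
            rw [h1'] at h
            have := (sv_eq_one_iff r (r + 1 - t.val)).mp h.symm
            omega
          exact sv_injOn r hℓ (Nat.sub_le _ _) h
        · intro h
          exact congrArg (sv r) h
      rw [hcl, Finset.sum_singleton, Fin.val_mk, lamv, if_neg (by omega), if_pos (by omega)]
    · -- the class of `(0,1)`: all `ℓ > r`
      have htv : t.val = r + 1 := by omega
      have hcl : minorClass (coefC n r) (kSet n r) (revBlock n r) t =
          Finset.univ.filter fun ℓ : Fin (n + 2) => r < ℓ.val := by
        ext ℓ
        rw [hmem, restrictOrdering_config_val n r hr, if_neg (by omega), htv,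
          (sv_eq_one_iff r (r + 1)).mpr (by omega), sv_eq_one_iff, Finset.mem_filter]
        simp
      rw [hcl]
      have hsum : ∑ ℓ ∈ Finset.univ.filter (fun ℓ : Fin (n + 2) => r < ℓ.val), lamv n r ℓ.val =
          ∑ ℓ ∈ Finset.univ.filter (fun ℓ : Fin (n + 2) => r < ℓ.val), ((-1) ^ n : ℤ) := by
        refine Finset.sum_congr rfl fun ℓ hℓ => ?_
        have := (Finset.mem_filter.mp hℓ).2
        rw [lamv, if_neg (by omega), if_neg (by omega)]
      rw [hsum, Finset.sum_const, card_filter_gt n r hr, htv, show r + 1 - (r + 1) = 0 by omega,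
        coef_zero, nsmul_eq_mul, mul_comm]

/-- A list of nonzero reals whose consecutive terms have opposite signs has `length − 1` sign
changes. [cite: BihanDickenstein2017, Thm. 5.1 (proof, our construction)] -/
theorem signVar_eq_length_sub_one : ∀ (l : List ℝ), l ≠ [] →
    (∀ (i : ℕ) (h : i + 1 < l.length), l[i] * l[i + 1] < 0) → signVar l = l.length - 1
  | [], h, _ => absurd rfl h
  | [a], _, _ => le_antisymm (signVar_le_length_sub_one [a]) (by simp)
  | a :: b :: l, _, h => by
    have hab : a * b < 0 := h 0 (by simp)
    have ha : a ≠ 0 := fun h0 => by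
      rw [h0, zero_mul] at hab
      exact lt_irrefl _ hab
    have hb : b ≠ 0 := fun h0 => by
      rw [h0, mul_zero] at hab
      exact lt_irrefl _ hab
    rw [signVar_cons_cons_of_ne_zero ha hb, if_pos hab,
      signVar_eq_length_sub_one (b :: l) (List.cons_ne_nil _ _) (fun i hi => by
        have := h (i + 1) (by simp only [List.length_cons] at hi ⊢; omega)
        simpa using this)]
    simp only [List.length_cons]
    omega

/-- **`sgnvar(s_α) = r + 1`** for our configuration. [cite: BihanDickenstein2017, Thm. 5.1 (proof, our construction)] -/
theorem signVar_sAlpha_config (n r : ℕ) (hr : r ≤ n) :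
    signVar (sAlpha (expo n r) (coefC n r) (kSet n r) (revBlock n r)) = r + 1 := by
  unfold sAlpha
  have hk := card_kSet n r hr
  rw [signVar_eq_length_sub_one]
  · rw [List.length_ofFn, hk]
    rfl
  · intro h
    have := congrArg List.length h
    rw [List.length_ofFn, hk] at this
    simp at this
  · intro i hi
    rw [List.length_ofFn] at hi
    simp only [List.getElem_ofFn, lambdaBar_config n r hr]
    have h := lamBarV_mul_succ_neg n r i (by rw [hk] at hi; omega)
    exact_mod_cast h

/-! ### The signature `{⌊r/2⌋ + 1, n + 1 − ⌊r/2⌋}` -/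

/-- Counting indices of `λ` through their values. [cite: BihanDickenstein2017, Thm. 5.1 (proof, our construction)] -/
theorem card_filter_affRel (n r : ℕ) (hr : r ≤ n) (p : ℤ → Prop) [DecidablePred p] :
    (Finset.univ.filter fun ℓ : Fin (n + 2) => p (affRel (expo n r) ℓ)).card =
      ((Finset.range (n + 2)).filter fun i => p (lamv n r i)).card := by
  rw [Finset.card_filter, Finset.card_filter]
  simp only [affRel_expo n r hr]
  exact Fin.sum_univ_eq_sum_range (fun i => if p (lamv n r i) then 1 else 0) (n + 2)

/-- `#{i ≤ r : i odd} = ⌊(r+1)/2⌋`. [cite: BihanDickenstein2017, Thm. 5.1 (proof, our construction)] -/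
theorem card_filter_odd_range (r : ℕ) : ((Finset.range (r + 1)).filter Odd).card = (r + 1) / 2 := by
  induction r with
  | zero => simp
  | succ r ih =>
    rw [Finset.range_add_one, Finset.filter_insert]
    by_cases h : Odd (r + 1)
    · rw [if_pos h, Finset.card_insert_of_notMem (by simp), ih]
      have := Nat.odd_iff.mp h
      omega
    · rw [if_neg h, ih]
      have := Nat.even_iff.mp (Nat.not_odd_iff_even.mp h)
      omega

/-- **The number of indices with `τ(i)` odd is `⌊r/2⌋ + 1`.** [cite: BihanDickenstein2017, Thm. 5.1 (proof, our construction)] -/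
theorem card_filter_odd_tau (n r : ℕ) (hr : r ≤ n) :
    ((Finset.range (n + 2)).filter fun i => Odd (tau r i)).card = r / 2 + 1 := by
  have hsplit : ((Finset.range (n + 2)).filter fun i => Odd (tau r i)) =
      ((Finset.range (n + 2)).filter fun i => i = 0 ∧ Odd (r + 1)) ∪
        ((Finset.range (r + 1)).filter Odd) := by
    ext i
    simp only [Finset.mem_filter, Finset.mem_range, Finset.mem_union, tau]
    constructor
    · rintro ⟨hi, hodd⟩
      split_ifs at hodd with h0 h1
      · exact Or.inl ⟨hi, h0, hodd⟩
      · exact Or.inr ⟨by omega, hodd⟩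
      · exact absurd hodd (by decide)
    · rintro (⟨hi, h0, hodd⟩ | ⟨hi, hodd⟩)
      · exact ⟨hi, by rw [if_pos h0]; exact hodd⟩
      · have hi0 : i ≠ 0 := by
          rintro rfl
          exact absurd hodd (by decide)
        exact ⟨by omega, by rw [if_neg hi0, if_pos (by omega)]; exact hodd⟩
  have hdisj : Disjoint ((Finset.range (n + 2)).filter fun i => i = 0 ∧ Odd (r + 1))
      ((Finset.range (r + 1)).filter Odd) := by
    rw [Finset.disjoint_left]
    rintro i hi hi'
    have h0 := (Finset.mem_filter.mp hi).2.1
    have hodd := (Finset.mem_filter.mp hi').2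
    rw [h0] at hodd
    exact absurd hodd (by decide)
  rw [hsplit, Finset.card_union_of_disjoint hdisj, card_filter_odd_range]
  have h0 : ((Finset.range (n + 2)).filter fun i => i = 0 ∧ Odd (r + 1)).card =
      if Odd (r + 1) then 1 else 0 := by
    by_cases h : Odd (r + 1)
    · rw [if_pos h]
      have : ((Finset.range (n + 2)).filter fun i => i = 0 ∧ Odd (r + 1)) = {0} := by
        ext i
        simp [h]
      rw [this, Finset.card_singleton]
    · rw [if_neg h]
      have : ((Finset.range (n + 2)).filter fun i => i = 0 ∧ Odd (r + 1)) = ∅ := by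
        ext i
        simp [h]
      rw [this, Finset.card_empty]
  rw [h0]
  by_cases h : Odd (r + 1)
  · rw [if_pos h]
    have := Nat.odd_iff.mp h
    omega
  · rw [if_neg h]
    have := Nat.even_iff.mp (Nat.not_odd_iff_even.mp h)
    omega

/-- **The signature of our circuit is `{⌊r/2⌋ + 1, n + 1 − ⌊r/2⌋}`.**
[cite: BihanDickenstein2017, Thm. 5.1 (proof, our construction)] -/
theorem signature_config (n r : ℕ) (hr : r ≤ n) :
    ({sigPos (expo n r), sigNeg (expo n r)} : Finset ℕ) = {r / 2 + 1, n + 1 - r / 2} := by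
  have hsum := sigPos_add_sigNeg (expo n r) (isCircuit_config n r hr)
  have hpos : sigPos (expo n r) = ((Finset.range (n + 2)).filter fun i => Even (n + tau r i)).card := by
    unfold sigPos
    rw [card_filter_affRel n r hr]
    congr 1
    exact Finset.filter_congr fun i _ => lamv_pos_iff n r i
  have hneg : sigNeg (expo n r) = ((Finset.range (n + 2)).filter fun i => Odd (n + tau r i)).card := by
    unfold sigNeg
    have h := card_filter_affRel n r hr (fun x => x < 0)
    beta_reduce at h
    rw [h]
    congr 1
    exact Finset.filter_congr fun i _ => lamv_neg_iff n r i
  have hT := card_filter_odd_tau n r hr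
  have hr2 : r / 2 ≤ n := (Nat.div_le_self r 2).trans hr
  rcases Nat.even_or_odd n with hn | hn
  · have hneg' : sigNeg (expo n r) = r / 2 + 1 := by
      rw [hneg, ← hT]
      congr 1
      refine Finset.filter_congr fun i _ => ?_
      rw [Nat.odd_add']
      exact ⟨fun h => h.mpr hn, fun h => ⟨fun _ => hn, fun _ => h⟩⟩
    have hpos' : sigPos (expo n r) = n + 1 - r / 2 := by omega
    rw [hpos', hneg', Finset.pair_comm]
  · have hpos' : sigPos (expo n r) = r / 2 + 1 := by
      rw [hpos, ← hT]
      congr 1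
      refine Finset.filter_congr fun i _ => ?_
      rw [Nat.even_add', ]
      exact ⟨fun h => h.mp hn, fun h => ⟨fun _ => h, fun _ => hn⟩⟩
    have hneg' : sigNeg (expo n r) = n + 1 - r / 2 := by omega
    rw [hpos', hneg']

end Thm51

end BD17

/-! ### Assembly -/

open BD17 BD17.Thm51 in
/-- **BD 2017, Thm. 5.1 — DISCHARGED** (`theorem BD2017_thm_5_1_holds : BD2017_thm_5_1`): the bounds
of Thm. 2.9 / Thm. 3.3 are attained. (1) For `0 ≤ r ≤ n`, `n > 0`, the configuration
`BD17.Thm51.expo n r`, `BD17.Thm51.coefC n r` with the ordering `BD17.Thm51.revBlock n r` and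
`K = BD17.Thm51.kSet n r` satisfies (1.3), (1.5), `sgnvar(s_α) = 1 + r` and `n_𝒜(C) = 1 + r`; (2) for
`a₊, a₋ > 0`, the same family with `n = a₊ + a₋ − 2`, `r = 2σ − 1` (`a₊ ≠ a₋`) resp. `r = 2σ − 2`
(`a₊ = a₋`), `σ = min{a₊, a₋}`, has signature `{a₊, a₋}` and `n_𝒜(C) = 2σ` resp. `2σ − 1`. Our
configurations replace the printed system (5.1) (whose count needs Viro patchworking [Stu]); see
the module docstring. [cite: BihanDickenstein2017, Thm. 5.1] -/
theorem BD2017_thm_5_1_holds : BD2017_thm_5_1 := by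
  refine ⟨fun r n hrn _ => ?_, fun ap am hap ham => ?_⟩
  · refine ⟨expo n r, coefC n r, revBlock n r, kSet n r, rankCond_config n r, posConeCond_config n r,
      isOrdering_config n r hrn, isMaxMinorSet_config n r hrn, ?_, finite_posSolutions_config n r hrn,
      ?_⟩
    · rw [signVar_sAlpha_config n r hrn, add_comm]
    · rw [numPosSols_config n r hrn, add_comm]
  · set n := ap + am - 2 with hn
    set r := if ap = am then 2 * min ap am - 2 else 2 * min ap am - 1 with hr
    have hrn : r ≤ n := by
      rw [hr, hn]
      split_ifs with h <;> omega
    refine ⟨n, expo n r, coefC n r, rankCond_config n r, posConeCond_config n r,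
      isCircuit_config n r hrn, ?_, finite_posSolutions_config n r hrn, ?_⟩
    · rw [signature_config n r hrn]
      have h1 : r / 2 + 1 = min ap am := by
        rw [hr]
        split_ifs with h <;> omega
      have h2 : n + 1 - r / 2 = max ap am := by
        rw [hn]
        omega
      rw [h1, h2]
      rcases le_total ap am with h | h
      · rw [min_eq_left h, max_eq_right h]
      · rw [min_eq_right h, max_eq_left h, Finset.pair_comm]
    · rw [numPosSols_config n r hrn, hr]
      split_ifs with h <;> omega

end Literature.Computability.AlgebraicComplexity
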